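import Mathlib.Analysis.SpecialFunctions.Pow.Asymptotics
import Mathlib.Analysis.SpecialFunctions.Pow.Real
import Mathlib.Analysis.SpecialFunctions.Log.Base
import Mathlib.Algebra.Order.Ring.Pow
import Mathlib.Data.Fintype.BigOperators
import Literature.Computability.FineGrained.MonotoneOV
import Literature.Computability.Complexity.MarkovInversion
import HarnessLib

/-!
# The monotone circuit complexity of `¬OV`: proof of `monotone_circuit_notOV_lower_bound`

Discharges (D-0014) the named fact `monotone_circuit_notOV_lower_bound` of `MonotoneOV.lean`
(**fine-grained.S25**): for every `ε > 0` there is `c ≥ 1` such that for all large `n` every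
circuit over `monotoneBasis = {∧₂, ∨₂}` computing `¬OV_{n, c ⌊log₂ n⌋}` (`notOVFn`) has at least
`n^{2-ε}` gates. This is Theorem 5 of T. Choudhury, N. Limaye, K. Sreenivasaiah, S. Srinivasan,
*New and Improved Concrete Lower Bounds for Orthogonal Vectors*, arXiv:2607.23799 (2026), §4,
whose proof (a variant of Razborov's approximation method with approximators that are
conjunctions of functions local to single vectors) is formalised here in full, in counting form.

## Proof outline (Choudhury et al. 2026, §4), and the choices made here

Fix `K ≥ max(3, 8/ε)`; alphabet `Fin A`, `A = 2K` (a bit is `1` iff its letter is `0`, so the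
uniform distribution on words is the paper's `D₁ = μ_p`, `p = 1/(2K)`); `c = 24K²`,
`d = c ⌊log₂ n⌋`; `m = ⌈n^{2/K}⌉`; property 3 of Definition 19 in counting form with threshold
`φ = ⌈n^{-1/K} A^d / 2⌉` words (`δ ≈ n^{-1/K}/2`).

* `PosΩ`, `posInp` — the sample space of `D₁` (a word per vector) and its input; `NegΩ`, `negInp` —
  the sample space `(i, j, b)` of `D₀` and its `0`-input (`u_i = b`, `v_j = ¬b`, all other vectors
  all-ones; the paper prints `v_j = b`, an evident typo since `u_i ⊥ v_j` is required).
* `Approx`, `Approx.Valid` — Definition 19 (`none : Option Approx` is the constant `0`);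
  `Approx.leaf/and/or`, `andO`, `orO` — the construction at leaves, `∧` and `∨` gates.
* `card_false_mul_le_pow` — Lemma 22 (the Kruskal–Katona-type amplification
  `Pr_{μ_{1/2}}[X = 0] ≤ Pr_{μ_p}[X = 0]^K`) by an explicit coupling: the OR of `K` independent
  `μ_p`-words lies below the `μ_{1/2}`-word `t ↦ [column t ∈ H]` for a half-size set `H` of
  `K`-letter columns containing all columns with a `0` (`exists_half`, by Bernoulli).
* `Approx.card_errAnd_le_of_left/right` — Lemma 21; `Approx.card_errOr_mul_le` — Lemma 23;
  `Approx.card_filter_eval_negInp_false_le` — Lemma 20; `card_filter_notOVFn_posInp_false_le` —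
  Lemma 17; all as cardinality bounds (probabilities cleared of denominators).
* `IsApprox`, `exists_isApprox_gates` — the one-sided bookkeeping of false negatives on `D₁` and
  false positives on `D₀` along a straight-line program (cf. `RApprox`/`exists_rApprox_gates` of
  the tree's Razborov–Alon–Boppana proof, `CliqueApproximators.lean`); `dichotomy` — Cases 1/2 of
  the proof of Theorem 5 in `ℕ`; `case1_arith`, `case2_arith`, `circuit_bound` — the asymptotics
  (`s ≥ n²` in Case 1, `s ≥ n^{2-4/K}/32 ≥ n^{2-ε}` in Case 2, eventually in `n`).
* `exists_monotone_circuit_notOVFn` — `¬OV_{n,d}` has a monotone circuit (`cktSize_of_monotone`),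
  so `circuitSizeOver monotoneBasis` is attained and the bound applies to it.

Circuits are the tree's straight-line programs (`Literature.Computability.Complexity.Circuit`,
`GateList.vals`, `wireOf`); fan-in-2 `{∧, ∨}` circuits without constants are a sub-model of the
paper's monotone circuits, so Theorem 5 applies verbatim.

## References

* T. Choudhury, N. Limaye, K. Sreenivasaiah, S. Srinivasan, *New and Improved Concrete Lower
  Bounds for Orthogonal Vectors*, arXiv:2607.23799 (2026): Def. 3, §4 (Def. 19, Lemmas 17, 20–23,
  Thm. 5) [arXiv260723799].
* A. A. Razborov, *Lower bounds on the monotone complexity of some Boolean functions*, Dokl.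
  Akad. Nauk SSSR 281 (1985) 798–801 (the approximation method).
-/

namespace Literature.Computability.FineGrained

open Finset
open scoped Classical

namespace MonotoneOV

/-! ### Counting in product spaces -/

/-- **Box count.** In the product space `ι → α` the number of points whose every coordinate `i`
lies in `T i` is `∏ i, #(T i)` (`Fintype.card_piFinset`, restated for `Finset.filter`). [folklore] -/
theorem card_filter_forall_mem {ι α : Type*} [Fintype ι] [DecidableEq ι] [Fintype α]
    [DecidableEq α] (T : ι → Finset α) :
    #(univ.filter fun ω : ι → α => ∀ i, ω i ∈ T i) = ∏ i, #(T i) := by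
  rw [← Fintype.card_piFinset]
  congr 1
  ext ω
  simp [Fintype.mem_piFinset]

/-- **Transposed box count.** In `ι → κ → α`, the number of points all of whose columns
`t ↦ (i ↦ ω i t)` lie in prescribed sets `T t` is `∏ t, #(T t)`. [folklore] -/
theorem card_filter_forall_col {ι κ α : Type*} [Fintype ι] [DecidableEq ι] [Fintype κ]
    [DecidableEq κ] [Fintype α] [DecidableEq α] (T : κ → Finset (ι → α)) :
    #(univ.filter fun ω : ι → κ → α => ∀ t, (fun i => ω i t) ∈ T t) = ∏ t, #(T t) := by
  rw [← card_filter_forall_mem T]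
  refine card_equiv (Equiv.piComm fun _ _ => α) fun ω => ?_
  simp only [mem_filter, mem_univ, true_and]
  exact Iff.rfl

/-- In `Bool`, anything below `false` is `false`. [folklore] -/
theorem eq_false_of_le_of_eq_false {a b : Bool} (h : a ≤ b) (hb : b = false) : a = false := by
  subst hb
  cases a
  · rfl
  · exact absurd h (by decide)

/-! ### The bit encoding of the biased distribution and the coupling lemma -/

/-- The bit encoding of a word over `Fin A`: a coordinate is `true` iff its symbol is `0`; under
the uniform distribution on words this is the product distribution `μ_{1/A}` of the paper
(Choudhury et al. 2026, §4, distribution `D₁ = μ_p`). [cite: arXiv260723799, §4] -/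
def bits {d A : ℕ} (w : Fin d → Fin A) : Fin d → Bool := fun t => decide ((w t : ℕ) = 0)

/-- Unfolding `bits`. [folklore] -/
@[simp] theorem bits_apply {d A : ℕ} (w : Fin d → Fin A) (t : Fin d) :
    bits w t = decide ((w t : ℕ) = 0) := rfl

/-- **Coupling lemma** (Choudhury et al. 2026, Lemma 22, in counting form with `q = 1/2`,
`p = 1/A`, `⌊q/p⌋` replaced by `K`). If `H` is a set of exactly half of the `K`-letter words over
`Fin A` containing every word with a `0`, then for every monotone `X : (Fin d → Bool) → Bool`,
`#{b | X b = 0} · #H^d ≤ #{w | X (bits w) = 0}^K`, i.e.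
`Pr_{μ_{1/2}}[X = 0] ≤ Pr_{μ_{1/A}}[X = 0]^K`: the OR of `K` independent `μ_{1/A}`-samples is
dominated by the `μ_{1/2}`-sample `t ↦ [column t ∈ H]`. [cite: arXiv260723799, Lemma 22] -/
theorem card_false_mul_le_pow {d A K : ℕ} (X : (Fin d → Bool) → Bool) (hX : Monotone X)
    (H : Finset (Fin K → Fin A)) (hZ : ∀ v : Fin K → Fin A, (∃ k, (v k : ℕ) = 0) → v ∈ H)
    (hH : #Hᶜ = #H) :
    #(univ.filter fun b : Fin d → Bool => X b = false) * #H ^ d ≤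
      #(univ.filter fun w : Fin d → Fin A => X (bits w) = false) ^ K := by
  classical
  -- the coupled `μ_{1/2}` sample
  set ψ : (Fin K → Fin d → Fin A) → (Fin d → Bool) := fun ω t => decide ((fun k => ω k t) ∈ H)
    with hψ
  -- its fibres all have `#H ^ d` elements
  have hfib : ∀ b : Fin d → Bool,
      #(univ.filter fun ω : Fin K → Fin d → Fin A => ψ ω = b) = #H ^ d := by
    intro b
    have hcol := card_filter_forall_col (ι := Fin K) (κ := Fin d) (α := Fin A)
      (fun t => if b t then H else Hᶜ)
    rw [Finset.prod_congr rfl (fun t _ => show #(if b t then H else Hᶜ) = #H by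
      split_ifs <;> simp [hH]), prod_const, card_univ, Fintype.card_fin] at hcol
    rw [← hcol]
    congr 1
    ext ω
    simp only [mem_filter, mem_univ, true_and]
    constructor
    · rintro rfl t
      by_cases h : (fun k => ω k t) ∈ H
      · simp [hψ, h]
      · simp [hψ, h]
    · intro h
      funext t
      have ht := h t
      cases hb : b t
      · rw [hb] at ht
        simp only [Bool.false_eq_true, ↓reduceIte, mem_compl] at ht
        simp [hψ, ht]
      · rw [hb] at ht
        simp only [↓reduceIte] at ht
        simp [hψ, ht]
  -- so the event `X ∘ ψ = 0` has `#{X = 0} · #H ^ d` elements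
  have hsum : #(univ.filter fun ω : Fin K → Fin d → Fin A => X (ψ ω) = false) =
      #(univ.filter fun b : Fin d → Bool => X b = false) * #H ^ d := by
    rw [card_eq_sum_card_fiberwise (f := ψ) (t := univ.filter fun b : Fin d → Bool => X b = false)]
    · rw [Finset.sum_congr rfl (fun b hb => ?_), sum_const, smul_eq_mul]
      rw [← hfib b]
      congr 1
      ext ω
      simp only [mem_filter, mem_univ, true_and]
      constructor
      · exact fun h => h.2
      · intro h
        refine ⟨?_, h⟩
        rw [h]
        exact (mem_filter.1 hb).2
    · intro ω hω
      have hω' := (mem_filter.1 hω).2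
      exact mem_filter.2 ⟨mem_univ _, hω'⟩
  -- domination: every `μ_{1/A}` sample lies below the coupled sample
  have hdom : (univ.filter fun ω : Fin K → Fin d → Fin A => X (ψ ω) = false) ⊆
      univ.filter fun ω => ∀ k, ω k ∈ univ.filter fun w : Fin d → Fin A => X (bits w) = false := by
    intro ω hω
    simp only [mem_filter, mem_univ, true_and] at hω ⊢
    intro k
    have hle : bits (ω k) ≤ ψ ω := fun t => by
      refine Bool.le_iff_imp.2 fun h => ?_
      simp only [bits_apply, decide_eq_true_eq] at h
      simp only [hψ, decide_eq_true_eq]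
      exact hZ _ ⟨k, h⟩
    exact eq_false_of_le_of_eq_false (hX hle) hω
  have hbox := card_filter_forall_mem (ι := Fin K)
    (fun _ => univ.filter fun w : Fin d → Fin A => X (bits w) = false)
  rw [prod_const, card_univ, Fintype.card_fin] at hbox
  calc #(univ.filter fun b : Fin d → Bool => X b = false) * #H ^ d
      = #(univ.filter fun ω : Fin K → Fin d → Fin A => X (ψ ω) = false) := hsum.symm
    _ ≤ #(univ.filter fun ω : Fin K → Fin d → Fin A =>
          ∀ k, ω k ∈ univ.filter fun w : Fin d → Fin A => X (bits w) = false) := card_le_card hdom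
    _ = #(univ.filter fun w : Fin d → Fin A => X (bits w) = false) ^ K := by convert hbox using 3

/-! ### A half-size set containing all words with a zero -/

/-- Bernoulli: `(2K)^K ≤ 2 (2K-1)^K`, i.e. `(1 - 1/(2K))^K ≥ 1/2`. [folklore] -/
theorem pow_le_two_mul_pred_pow (K : ℕ) (hK : 1 ≤ K) : (2 * K) ^ K ≤ 2 * (2 * K - 1) ^ K := by
  have hKr : (1 : ℝ) ≤ K := by exact_mod_cast hK
  have hpos : (0 : ℝ) < 2 * K := by linarith
  -- Bernoulli's inequality in `ℝ`
  have hB := one_add_mul_le_pow (a := -(1 / (2 * (K : ℝ)))) (by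
    have : (1 : ℝ) / (2 * K) ≤ 1 := by
      rw [div_le_one hpos]; linarith
    linarith) K
  have h1 : (1 : ℝ) + K * -(1 / (2 * K)) = 1 / 2 := by
    field_simp
    ring
  rw [h1] at hB
  have h2 : ((2 * K - 1 : ℕ) : ℝ) = 2 * K - 1 := by
    rw [Nat.cast_sub (by omega)]
    push_cast
    ring
  have h3 : (1 : ℝ) + -(1 / (2 * K)) = (2 * K - 1) / (2 * K) := by
    field_simp
    ring
  rw [h3, div_pow] at hB
  have h4 : (2 * (K : ℝ)) ^ K / 2 ≤ (2 * K - 1) ^ K := by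
    have := (le_div_iff₀ (pow_pos hpos K)).1 hB
    linarith
  have h5 : ((2 * K : ℕ) : ℝ) ^ K ≤ 2 * ((2 * K - 1 : ℕ) : ℝ) ^ K := by
    rw [h2]
    push_cast
    linarith
  exact_mod_cast h5

/-- For `K ≥ 1` there is a set `H` of exactly half of the `K`-letter words over `Fin (2K)` that
contains every word having a letter `0` (there are `(2K)^K - (2K-1)^K ≤ (2K)^K / 2` of those,
by Bernoulli). This realises the domination `μ_{q'} ≤ μ_{1/2}` of the proof of Lemma 22 of
Choudhury et al. (2026) exactly. [cite: arXiv260723799, Lemma 22] -/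
theorem exists_half (K : ℕ) (hK : 1 ≤ K) :
    ∃ H : Finset (Fin K → Fin (2 * K)),
      (∀ v : Fin K → Fin (2 * K), (∃ k, (v k : ℕ) = 0) → v ∈ H) ∧ #Hᶜ = #H := by
  classical
  set Z : Finset (Fin K → Fin (2 * K)) := univ.filter fun v => ∃ k, (v k : ℕ) = 0 with hZ
  -- the complement of `Z` is a box of side `2K - 1`
  have hZc : #Zᶜ = (2 * K - 1) ^ K := by
    have hbox := card_filter_forall_mem (ι := Fin K)
      (fun _ => (univ : Finset (Fin (2 * K))).filter fun a : Fin (2 * K) => ¬ (a : ℕ) = 0)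
    have hside : #((univ : Finset (Fin (2 * K))).filter fun a : Fin (2 * K) => ¬ (a : ℕ) = 0) =
        2 * K - 1 := by
      have h0 : #((univ : Finset (Fin (2 * K))).filter fun a : Fin (2 * K) => (a : ℕ) = 0) = 1 := by
        rw [card_eq_one]
        refine ⟨⟨0, by omega⟩, ?_⟩
        ext a
        simp [Fin.ext_iff]
      have := card_filter_add_card_filter_not (s := (univ : Finset (Fin (2 * K))))
        (fun a : Fin (2 * K) => (a : ℕ) = 0)
      rw [h0, card_univ, Fintype.card_fin] at this
      omega
    rw [prod_const, card_univ, Fintype.card_fin, hside] at hbox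
    rw [← hbox]
    congr 1
    ext v
    simp [hZ]
  have htot : #Z + #Zᶜ = (2 * K) ^ K := by
    rw [card_add_card_compl, Fintype.card_pi_const, Fintype.card_fin]
  have hB := pow_le_two_mul_pred_pow K hK
  -- `(2K)^K` is even
  obtain ⟨h, hh⟩ : ∃ h, (2 * K) ^ K = 2 * h := by
    obtain ⟨K', rfl⟩ : ∃ K', K = K' + 1 := ⟨K - 1, by omega⟩
    exact ⟨(2 * (K' + 1)) ^ K' * (K' + 1), by ring⟩
  have hZle : #Z ≤ h := by omega
  obtain ⟨H, hZH, -, hHcard⟩ := exists_subsuperset_card_eq (subset_univ Z) hZle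
    (show h ≤ #(univ : Finset (Fin K → Fin (2 * K))) by
      rw [card_univ, Fintype.card_pi_const, Fintype.card_fin]; omega)
  refine ⟨H, fun v hv => hZH (mem_filter.2 ⟨mem_univ _, hv⟩), ?_⟩
  rw [card_compl, Fintype.card_pi_const, Fintype.card_fin, hHcard]
  omega


/-! ### Inputs of `¬OV_{n,d}` and the two test distributions -/

variable {n d A : ℕ}

/-- The input positions of `¬OV_{n,d}`: bit `t` of vector `i` of list `s ∈ {0, 1}`. [folklore] -/
abbrev Idx (n d : ℕ) : Type := Fin 2 × Fin n × Fin d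

/-- The vector `u_i` (list `A`, index `0`) of an input of `¬OV_{n,d}`. [folklore] -/
def vecU (x : Idx n d → Bool) (i : Fin n) : Fin d → Bool := fun t => x (0, i, t)

/-- The vector `v_j` (list `B`, index `1`) of an input of `¬OV_{n,d}`. [folklore] -/
def vecV (x : Idx n d → Bool) (j : Fin n) : Fin d → Bool := fun t => x (1, j, t)

/-- `¬OV_{n,d}(x) = 1` iff no `u_i` is orthogonal to a `v_j` (Choudhury et al. 2026, Def. 3,
`Int_{n,d}`). [cite: arXiv260723799, Def. 3] -/
theorem notOVFn_eq_true_iff (x : Idx n d → Bool) :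
    Cryptography.notOVFn n d x = true ↔ ∀ i j, ¬ Cryptography.AreOrthogonal (vecU x i) (vecV x j) := by
  simp only [Cryptography.notOVFn, Cryptography.ovFn, Cryptography.OVInstance.HasOrthogonalPair,
    Cryptography.OVInstance.ofBits, Bool.not_eq_true', decide_eq_false_iff_not, not_exists]
  rfl

/-- `¬OV_{n,d}(x) = 0` iff some `u_i` is orthogonal to some `v_j`. [cite: arXiv260723799, Def. 3] -/
theorem notOVFn_eq_false_iff (x : Idx n d → Bool) :
    Cryptography.notOVFn n d x = false ↔ ∃ i j, Cryptography.AreOrthogonal (vecU x i) (vecV x j) := by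
  have h := notOVFn_eq_true_iff x
  constructor
  · intro hf
    by_contra hne
    push Not at hne
    rw [← h, hf] at hne
    exact Bool.false_ne_true hne
  · rintro ⟨i, j, hij⟩
    cases hx : Cryptography.notOVFn n d x
    · rfl
    · exact absurd hij ((h.1 hx) i j)

/-- The sample space of the distribution `D₁ = μ_{1/A}` on (mostly) `1`-inputs: a word of
length `d` over `Fin A` for each of the `2n` vectors (Choudhury et al. 2026, §4).
[cite: arXiv260723799, §4] -/
abbrev PosΩ (n d A : ℕ) : Type := Fin 2 × Fin n → Fin d → Fin A

/-- The input of `¬OV_{n,d}` encoded by a positive sample: bit `(s, i, t)` is `1` iff letter `t`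
of word `(s, i)` is `0` (Choudhury et al. 2026, §4, `D₁`). [cite: arXiv260723799, §4] -/
def posInp (ω : PosΩ n d A) : Idx n d → Bool := fun v => decide ((ω (v.1, v.2.1) v.2.2 : ℕ) = 0)

/-- Under `posInp`, `u_i` is the bit encoding of the word `(0, i)`. [folklore] -/
@[simp] theorem vecU_posInp (ω : PosΩ n d A) (i : Fin n) : vecU (posInp ω) i = bits (ω (0, i)) := rfl

/-- Under `posInp`, `v_j` is the bit encoding of the word `(1, j)`. [folklore] -/
@[simp] theorem vecV_posInp (ω : PosΩ n d A) (j : Fin n) : vecV (posInp ω) j = bits (ω (1, j)) := rfl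

/-- The sample space of the distribution `D₀` on `0`-inputs: the two planted positions `i, j`
and the planted vector `b` (Choudhury et al. 2026, §4, steps 1–2). [cite: arXiv260723799, §4] -/
abbrev NegΩ (n d : ℕ) : Type := Fin n × Fin n × (Fin d → Bool)

/-- The `0`-input of a negative sample `(i, j, b)`: `u_i = b`, `v_j = ¬b` (so that `u_i ⊥ v_j`;
the paper prints `v_j = b`, a typo), all other vectors all-ones (Choudhury et al. 2026, §4,
steps 3–4). [cite: arXiv260723799, §4] -/
def negInp (ω : NegΩ n d) : Idx n d → Bool := fun v =>
  if (v.1 : ℕ) = 0 then (if v.2.1 = ω.1 then ω.2.2 v.2.2 else true)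
  else (if v.2.1 = ω.2.1 then !ω.2.2 v.2.2 else true)

/-- Under `negInp (i, j, b)`, `u_i = b` and the other `u`'s are all-ones. [folklore] -/
theorem vecU_negInp (ω : NegΩ n d) (i : Fin n) :
    vecU (negInp ω) i = if i = ω.1 then ω.2.2 else fun _ => true := by
  funext t
  unfold vecU negInp
  split_ifs <;> simp_all

/-- Under `negInp (i, j, b)`, `v_j = ¬b` and the other `v`'s are all-ones. [folklore] -/
theorem vecV_negInp (ω : NegΩ n d) (j : Fin n) :
    vecV (negInp ω) j = if j = ω.2.1 then (fun t => !ω.2.2 t) else fun _ => true := by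
  funext t
  unfold vecV negInp
  split_ifs <;> simp_all

/-- Every negative sample encodes a `0`-input of `¬OV_{n,d}` (`u_i = b ⊥ ¬b = v_j`).
[cite: arXiv260723799, §4] -/
theorem notOVFn_negInp (ω : NegΩ n d) : Cryptography.notOVFn n d (negInp ω) = false := by
  rw [notOVFn_eq_false_iff]
  refine ⟨ω.1, ω.2.1, fun t ht => ?_⟩
  rw [vecU_negInp, vecV_negInp, if_pos rfl, if_pos rfl] at ht
  cases h : ω.2.2 t <;> simp [h] at ht

/-! ### Approximators (Choudhury et al. 2026, Definition 19) -/

/-- The data of a (non-zero) approximator `⋀_{i ∈ S_U} B_i(u_i) ∧ ⋀_{j ∈ S_V} C_j(v_j)`: the index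
sets and, for every index, a local function (Choudhury et al. 2026, Def. 19; the constant `0`
approximator is `none : Option (Approx n d)`, the constant `1` is `S_U = S_V = ∅`).
[cite: arXiv260723799, Definition 19] -/
structure Approx (n d : ℕ) where
  /-- the indices `S_U` of the constrained `u`-vectors -/
  SU : Finset (Fin n)
  /-- the indices `S_V` of the constrained `v`-vectors -/
  SV : Finset (Fin n)
  /-- the local functions `B_i` on the `u`-vectors -/
  B : Fin n → (Fin d → Bool) → Bool
  /-- the local functions `C_j` on the `v`-vectors -/
  C : Fin n → (Fin d → Bool) → Bool

namespace Approx

/-- The Boolean function of an approximator: the conjunction of its local functions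
(Choudhury et al. 2026, Def. 19). [cite: arXiv260723799, Definition 19] -/
def eval (F : Approx n d) (x : Idx n d → Bool) : Bool :=
  decide ((∀ i ∈ F.SU, F.B i (vecU x i) = true) ∧ ∀ j ∈ F.SV, F.C j (vecV x j) = true)

/-- Unfolding `eval`. [folklore] -/
theorem eval_eq_true_iff (F : Approx n d) (x : Idx n d → Bool) :
    F.eval x = true ↔ (∀ i ∈ F.SU, F.B i (vecU x i) = true) ∧ ∀ j ∈ F.SV, F.C j (vecV x j) = true := by
  simp [eval]

/-- The invariants of an `(m, δ)`-approximator (Choudhury et al. 2026, Def. 19, properties 1–3,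
with property 3 in counting form `φ ≤ #{w | B_i (bits w) = 0}` for the threshold
`φ ≈ δ · A^d`), together with the bookkeeping facts that the local functions are monotone, accept
the all-ones vector, and are `≡ 1` off the index sets. [cite: arXiv260723799, Definition 19] -/
structure Valid (A m φ : ℕ) (F : Approx n d) : Prop where
  /-- property 2 for `S_U` -/
  cardU : #F.SU ≤ m
  /-- property 2 for `S_V` -/
  cardV : #F.SV ≤ m
  /-- the `B_i` are monotone -/
  monoB : ∀ i, Monotone (F.B i)
  /-- the `C_j` are monotone -/
  monoC : ∀ j, Monotone (F.C j)
  /-- the `B_i` are not identically `0` -/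
  topB : ∀ i, F.B i (fun _ => true) = true
  /-- the `C_j` are not identically `0` -/
  topC : ∀ j, F.C j (fun _ => true) = true
  /-- off `S_U` the `B_i` are identically `1` -/
  offB : ∀ i ∉ F.SU, ∀ u, F.B i u = true
  /-- off `S_V` the `C_j` are identically `1` -/
  offC : ∀ j ∉ F.SV, ∀ u, F.C j u = true
  /-- property 3 for the `B_i` -/
  thrB : ∀ i ∈ F.SU, φ ≤ #(univ.filter fun w : Fin d → Fin A => F.B i (bits w) = false)
  /-- property 3 for the `C_j` -/
  thrC : ∀ j ∈ F.SV, φ ≤ #(univ.filter fun w : Fin d → Fin A => F.C j (bits w) = false)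

/-! #### Leaves -/

/-- The approximator of the input variable `(s, i, t)`: the single local function `u ↦ u_t` on
vector `i` of list `s` (Choudhury et al. 2026, §4, "Leaves"). [cite: arXiv260723799, §4] -/
def leaf (v : Idx n d) : Approx n d :=
  if (v.1 : ℕ) = 0 then
    ⟨{v.2.1}, ∅, fun i u => if i = v.2.1 then u v.2.2 else true, fun _ _ => true⟩
  else
    ⟨∅, {v.2.1}, fun _ _ => true, fun j u => if j = v.2.1 then u v.2.2 else true⟩

/-- The leaf approximator computes its variable exactly. [cite: arXiv260723799, §4] -/
theorem eval_leaf (v : Idx n d) (x : Idx n d → Bool) : (leaf v).eval x = x v := by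
  obtain ⟨s, i, t⟩ := v
  unfold leaf eval
  by_cases hs : (s : ℕ) = 0
  · have hs' : s = 0 := Fin.ext hs
    subst hs'
    simp [vecU]
  · have hs' : s = 1 := Fin.ext (by have := s.isLt; simp only [Fin.val_one]; omega)
    subst hs'
    simp [vecV]

/-- The number of words whose letter `t` is not `0` is `(A - 1) · A^(d-1)`. [folklore] -/
theorem card_filter_letter_ne_zero (hA : 1 ≤ A) (t : Fin d) :
    #(univ.filter fun w : Fin d → Fin A => ¬ ((w t : ℕ) = 0)) = (A - 1) * A ^ (d - 1) := by
  set F : Finset (Fin A) := univ.filter fun a : Fin A => ¬ ((a : ℕ) = 0) with hF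
  have hside : #F = A - 1 := by
    have h0 : #((univ : Finset (Fin A)).filter fun a : Fin A => (a : ℕ) = 0) = 1 := by
      rw [card_eq_one]
      refine ⟨⟨0, by omega⟩, ?_⟩
      ext a
      simp [Fin.ext_iff]
    have := card_filter_add_card_filter_not (s := (univ : Finset (Fin A)))
      (fun a : Fin A => (a : ℕ) = 0)
    rw [h0, card_univ, Fintype.card_fin] at this
    rw [hF]
    omega
  have hbox := card_filter_forall_mem (ι := Fin d) (fun t' => if t' = t then F else univ)
  have hprod : ∏ t', #(if t' = t then F else (univ : Finset (Fin A))) = (A - 1) * A ^ (d - 1) := by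
    rw [← mul_prod_erase univ _ (mem_univ t), if_pos rfl, hside]
    congr 1
    rw [Finset.prod_congr rfl (fun t' ht' => ?_), prod_const, card_erase_of_mem (mem_univ t),
      card_univ, Fintype.card_fin]
    rw [if_neg (ne_of_mem_erase ht'), card_univ, Fintype.card_fin]
  rw [hprod] at hbox
  rw [← hbox]
  congr 1
  ext w
  simp only [mem_filter, mem_univ, true_and]
  constructor
  · intro h t'
    split_ifs with h'
    · subst h'
      simpa [hF] using h
    · exact mem_univ _
  · intro h
    have := h t
    rw [if_pos rfl] at this
    simpa [hF] using this

/-- The leaf approximators are valid as soon as `m ≥ 1` and `φ ≤ (A-1) A^(d-1)` (property 3 for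
the variable `u ↦ u_t`: `Pr_{μ_{1/A}}[u_t = 0] = 1 - 1/A`). [cite: arXiv260723799, §4] -/
theorem valid_leaf {m φ : ℕ} (hA : 1 ≤ A) (hm : 1 ≤ m) (hφ : φ ≤ (A - 1) * A ^ (d - 1))
    (v : Idx n d) : (leaf v).Valid A m φ := by
  obtain ⟨s, i, t⟩ := v
  have hmono : Monotone fun u : Fin d → Bool => u t := fun u u' h => h t
  have hthr : φ ≤ #(univ.filter fun w : Fin d → Fin A => (bits w) t = false) := by
    refine hφ.trans (le_of_eq ?_)
    rw [← card_filter_letter_ne_zero hA t]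
    congr 1
    ext w
    simp
  unfold leaf
  by_cases hs : (s : ℕ) = 0
  · simp only [hs, ↓reduceIte]
    refine ⟨by simpa using hm, by simp, fun i' => ?_, fun _ => monotone_const, fun i' => by simp,
      fun _ => rfl, fun i' hi' u => ?_, fun _ _ _ => rfl, fun i' hi' => ?_, fun j hj => by simp at hj⟩
    · by_cases h : i' = i
      · simp only [h, ↓reduceIte]; exact hmono
      · simp only [h, ↓reduceIte]; exact monotone_const
    · rw [mem_singleton] at hi'
      simp [hi']
    · rw [mem_singleton] at hi'
      subst hi'
      simpa using hthr
  · simp only [hs, ↓reduceIte]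
    refine ⟨by simp, by simpa using hm, fun _ => monotone_const, fun j' => ?_, fun _ => rfl,
      fun j' => by simp, fun _ _ _ => rfl, fun j' hj' u => ?_, fun i hi => by simp at hi, fun j' hj' => ?_⟩
    · by_cases h : j' = i
      · simp only [h, ↓reduceIte]; exact hmono
      · simp only [h, ↓reduceIte]; exact monotone_const
    · rw [mem_singleton] at hj'
      simp [hj']
    · rw [mem_singleton] at hj'
      subst hj'
      simpa using hthr

/-! #### AND gates -/

/-- The conjunction of two approximators: unions of the index sets, conjunctions of the local
functions (Choudhury et al. 2026, §4, case `g ∧ h`, and the `P_i, Q_j` of the proof of Lemma 21).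
[cite: arXiv260723799, Lemma 21] -/
def and (F G : Approx n d) : Approx n d :=
  ⟨F.SU ∪ G.SU, F.SV ∪ G.SV, fun i u => F.B i u && G.B i u, fun j u => F.C j u && G.C j u⟩

/-- The conjunction approximator computes the conjunction (the local functions being `≡ 1` off
the index sets). [cite: arXiv260723799, §4] -/
theorem eval_and {m φ : ℕ} {F G : Approx n d} (hF : F.Valid A m φ) (hG : G.Valid A m φ)
    (x : Idx n d → Bool) : (F.and G).eval x = (F.eval x && G.eval x) := by
  apply Bool.eq_iff_iff.2
  simp only [eval_eq_true_iff, Bool.and_eq_true, and, mem_union]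
  constructor
  · rintro ⟨hU, hV⟩
    exact ⟨⟨fun i hi => (hU i (Or.inl hi)).1, fun j hj => (hV j (Or.inl hj)).1⟩,
      ⟨fun i hi => (hU i (Or.inr hi)).2, fun j hj => (hV j (Or.inr hj)).2⟩⟩
  · rintro ⟨⟨hFU, hFV⟩, ⟨hGU, hGV⟩⟩
    refine ⟨fun i hi => ⟨?_, ?_⟩, fun j hj => ⟨?_, ?_⟩⟩
    · by_cases h : i ∈ F.SU
      · exact hFU i h
      · exact hF.offB i h _
    · by_cases h : i ∈ G.SU
      · exact hGU i h
      · exact hG.offB i h _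
    · by_cases h : j ∈ F.SV
      · exact hFV j h
      · exact hF.offC j h _
    · by_cases h : j ∈ G.SV
      · exact hGV j h
      · exact hG.offC j h _

/-- The conjunction of two Boolean-valued monotone functions is monotone. [folklore] -/
theorem monotone_and {α : Type*} [Preorder α] {f g : α → Bool} (hf : Monotone f) (hg : Monotone g) :
    Monotone fun a => f a && g a := fun a b h => by
  have h1 := Bool.le_iff_imp.1 (hf h)
  have h2 := Bool.le_iff_imp.1 (hg h)
  refine Bool.le_iff_imp.2 fun hab => ?_
  rw [Bool.and_eq_true] at hab ⊢
  exact ⟨h1 hab.1, h2 hab.2⟩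

/-- The disjunction of two Boolean-valued monotone functions is monotone. [folklore] -/
theorem monotone_or {α : Type*} [Preorder α] {f g : α → Bool} (hf : Monotone f) (hg : Monotone g) :
    Monotone fun a => f a || g a := fun a b h => by
  have h1 := Bool.le_iff_imp.1 (hf h)
  have h2 := Bool.le_iff_imp.1 (hg h)
  refine Bool.le_iff_imp.2 fun hab => ?_
  rw [Bool.or_eq_true] at hab ⊢
  exact hab.imp h1 h2

/-- Property 3 survives conjunction on the `u`-side: `Pr[B_i ∧ B'_i = 0] ≥ Pr[B_i = 0]`.
[cite: arXiv260723799, §4] -/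
theorem thrB_and {m φ : ℕ} {F G : Approx n d} (hF : F.Valid A m φ) (hG : G.Valid A m φ)
    {i : Fin n} (hi : i ∈ F.SU ∪ G.SU) :
    φ ≤ #(univ.filter fun w : Fin d → Fin A => (F.and G).B i (bits w) = false) := by
  simp only [and, mem_union] at hi ⊢
  rcases hi with hi | hi
  · refine (hF.thrB i hi).trans (card_le_card fun w hw => ?_)
    simp only [mem_filter, mem_univ, true_and] at hw ⊢
    simp [hw]
  · refine (hG.thrB i hi).trans (card_le_card fun w hw => ?_)
    simp only [mem_filter, mem_univ, true_and] at hw ⊢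
    simp [hw]

/-- Property 3 survives conjunction on the `v`-side. [cite: arXiv260723799, §4] -/
theorem thrC_and {m φ : ℕ} {F G : Approx n d} (hF : F.Valid A m φ) (hG : G.Valid A m φ)
    {j : Fin n} (hj : j ∈ F.SV ∪ G.SV) :
    φ ≤ #(univ.filter fun w : Fin d → Fin A => (F.and G).C j (bits w) = false) := by
  simp only [and, mem_union] at hj ⊢
  rcases hj with hj | hj
  · refine (hF.thrC j hj).trans (card_le_card fun w hw => ?_)
    simp only [mem_filter, mem_univ, true_and] at hw ⊢
    simp [hw]
  · refine (hG.thrC j hj).trans (card_le_card fun w hw => ?_)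
    simp only [mem_filter, mem_univ, true_and] at hw ⊢
    simp [hw]

/-- If the merged index sets are small enough, the conjunction is again a valid approximator
(Choudhury et al. 2026, §4, case `g ∧ h`: "conjunctions of local functions are local, and property
3 is preserved"). [cite: arXiv260723799, §4] -/
theorem valid_and {m φ : ℕ} {F G : Approx n d} (hF : F.Valid A m φ) (hG : G.Valid A m φ)
    (hU : #(F.SU ∪ G.SU) ≤ m) (hV : #(F.SV ∪ G.SV) ≤ m) : (F.and G).Valid A m φ := by
  refine ⟨hU, hV, fun i => monotone_and (hF.monoB i) (hG.monoB i),
    fun j => monotone_and (hF.monoC j) (hG.monoC j), fun i => ?_, fun j => ?_,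
    fun i hi u => ?_, fun j hj u => ?_, fun i hi => thrB_and hF hG hi, fun j hj => thrC_and hF hG hj⟩
  · simp [and, hF.topB i, hG.topB i]
  · simp [and, hF.topC j, hG.topC j]
  · simp only [and, mem_union, not_or] at hi ⊢
    simp [hF.offB i hi.1, hG.offB i hi.2]
  · simp only [and, mem_union, not_or] at hj ⊢
    simp [hF.offC j hj.1, hG.offC j hj.2]

/-! #### OR gates -/

/-- The `u`-indices kept at an OR gate: those common to both approximators whose merged local
function `B_i ∨ B'_i` still satisfies property 3 (the set `T_U` of Choudhury et al. 2026, §4,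
case `g ∨ h`). [cite: arXiv260723799, §4] -/
def orSU (A φ : ℕ) (F G : Approx n d) : Finset (Fin n) :=
  (F.SU ∩ G.SU).filter fun i =>
    φ ≤ #(univ.filter fun w : Fin d → Fin A => (F.B i (bits w) || G.B i (bits w)) = false)

/-- The `v`-indices kept at an OR gate (the set `T_V` of Choudhury et al. 2026, §4).
[cite: arXiv260723799, §4] -/
def orSV (A φ : ℕ) (F G : Approx n d) : Finset (Fin n) :=
  (F.SV ∩ G.SV).filter fun j =>
    φ ≤ #(univ.filter fun w : Fin d → Fin A => (F.C j (bits w) || G.C j (bits w)) = false)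

/-- The disjunction of two approximators: of the CNF expansion of `F ∨ G` keep only the local
clauses `B_i ∨ B'_i`, `C_j ∨ C'_j` that satisfy property 3 (Choudhury et al. 2026, §4, case
`g ∨ h`). [cite: arXiv260723799, §4] -/
def or (A φ : ℕ) (F G : Approx n d) : Approx n d :=
  ⟨orSU A φ F G, orSV A φ F G,
    fun i u => if i ∈ orSU A φ F G then F.B i u || G.B i u else true,
    fun j u => if j ∈ orSV A φ F G then F.C j u || G.C j u else true⟩

/-- The kept `u`-indices come from both operands. [folklore] -/
theorem orSU_subset (A φ : ℕ) (F G : Approx n d) : orSU A φ F G ⊆ F.SU ∩ G.SU := filter_subset _ _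

/-- The kept `v`-indices come from both operands. [folklore] -/
theorem orSV_subset (A φ : ℕ) (F G : Approx n d) : orSV A φ F G ⊆ F.SV ∩ G.SV := filter_subset _ _

/-- The disjunction approximator is implied by its left operand (dropping clauses of a CNF only
weakens it). [cite: arXiv260723799, §4] -/
theorem eval_or_of_left (A φ : ℕ) {F : Approx n d} (G : Approx n d) {x : Idx n d → Bool}
    (h : F.eval x = true) : (F.or A φ G).eval x = true := by
  rw [eval_eq_true_iff] at h ⊢
  refine ⟨fun i hi => ?_, fun j hj => ?_⟩
  · have hi₀ : i ∈ orSU A φ F G := hi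
    have hi' := (mem_inter.1 (orSU_subset A φ F G hi₀)).1
    simp only [or]
    rw [if_pos hi₀, h.1 i hi', Bool.true_or]
  · have hj₀ : j ∈ orSV A φ F G := hj
    have hj' := (mem_inter.1 (orSV_subset A φ F G hj₀)).1
    simp only [or]
    rw [if_pos hj₀, h.2 j hj', Bool.true_or]

/-- The disjunction approximator is implied by its right operand. [cite: arXiv260723799, §4] -/
theorem eval_or_of_right (A φ : ℕ) (F : Approx n d) {G : Approx n d} {x : Idx n d → Bool}
    (h : G.eval x = true) : (F.or A φ G).eval x = true := by
  rw [eval_eq_true_iff] at h ⊢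
  refine ⟨fun i hi => ?_, fun j hj => ?_⟩
  · have hi₀ : i ∈ orSU A φ F G := hi
    have hi' := (mem_inter.1 (orSU_subset A φ F G hi₀)).2
    simp only [or]
    rw [if_pos hi₀, h.1 i hi', Bool.or_true]
  · have hj₀ : j ∈ orSV A φ F G := hj
    have hj' := (mem_inter.1 (orSV_subset A φ F G hj₀)).2
    simp only [or]
    rw [if_pos hj₀, h.2 j hj', Bool.or_true]

/-- The disjunction of valid approximators is valid (Choudhury et al. 2026, §4, case `g ∨ h`:
`|T_U| ≤ |S_U^g ∩ S_U^h| ≤ m`, and property 3 holds by the choice of `T_U, T_V`).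
[cite: arXiv260723799, §4] -/
theorem valid_or {m φ : ℕ} {F G : Approx n d} (hF : F.Valid A m φ) (hG : G.Valid A m φ) :
    (F.or A φ G).Valid A m φ := by
  refine ⟨?_, ?_, fun i => ?_, fun j => ?_, fun i => ?_, fun j => ?_, fun i hi u => ?_,
    fun j hj u => ?_, fun i hi => ?_, fun j hj => ?_⟩
  · exact (card_le_card ((orSU_subset A φ F G).trans inter_subset_left)).trans hF.cardU
  · exact (card_le_card ((orSV_subset A φ F G).trans inter_subset_left)).trans hF.cardV
  · simp only [or]
    by_cases h : i ∈ orSU A φ F G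
    · simp only [h, ↓reduceIte]
      exact monotone_or (hF.monoB i) (hG.monoB i)
    · simp only [h, ↓reduceIte]
      exact monotone_const
  · simp only [or]
    by_cases h : j ∈ orSV A φ F G
    · simp only [h, ↓reduceIte]
      exact monotone_or (hF.monoC j) (hG.monoC j)
    · simp only [h, ↓reduceIte]
      exact monotone_const
  · simp [or, hF.topB i]
  · simp [or, hF.topC j]
  · simp only [or] at hi ⊢
    rw [if_neg hi]
  · simp only [or] at hj ⊢
    rw [if_neg hj]
  · simp only [or] at hi ⊢
    have h := (mem_filter.1 hi).2
    simp only [hi, ↓reduceIte]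
    exact h
  · simp only [or] at hj ⊢
    have h := (mem_filter.1 hj).2
    simp only [hj, ↓reduceIte]
    exact h

end Approx



/-! ### Elementary counting facts about the two sample spaces -/

/-- `#{w | f w = 1} + #{w | f w = 0} = A^d` for words of length `d` over `Fin A`. [folklore] -/
theorem card_true_add_card_false (f : (Fin d → Fin A) → Bool) :
    #(univ.filter fun w : Fin d → Fin A => f w = true) +
      #(univ.filter fun w : Fin d → Fin A => f w = false) = A ^ d := by
  have h := card_filter_add_card_filter_not (s := (univ : Finset (Fin d → Fin A)))
    (fun w : Fin d → Fin A => f w = true)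
  simp only [Bool.not_eq_true] at h
  rw [h, card_univ, Fintype.card_fun, Fintype.card_fin, Fintype.card_fin]

/-- There are `2^d` Boolean vectors of length `d`. [folklore] -/
theorem card_boolVec : Fintype.card (Fin d → Bool) = 2 ^ d := by
  rw [Fintype.card_fun, Fintype.card_bool, Fintype.card_fin]

/-- Exponent bookkeeping: for `x ≤ y` and `a ≤ b ≤ N`, `x^b y^(N-b) ≤ x^a y^(N-a)`. [folklore] -/
theorem pow_mul_pow_sub_antitone {x y a b N : ℕ} (hxy : x ≤ y) (hab : a ≤ b) (hb : b ≤ N) :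
    x ^ b * y ^ (N - b) ≤ x ^ a * y ^ (N - a) := by
  obtain ⟨r, rfl⟩ := Nat.exists_eq_add_of_le hab
  calc x ^ (a + r) * y ^ (N - (a + r)) = x ^ a * (x ^ r * y ^ (N - (a + r))) := by ring
    _ ≤ x ^ a * (y ^ r * y ^ (N - (a + r))) :=
        Nat.mul_le_mul_left _ (Nat.mul_le_mul_right _ (Nat.pow_le_pow_left hxy r))
    _ = x ^ a * y ^ (N - a) := by
        rw [← pow_add]
        congr 2
        omega

/-- **Box bound on one side.** The positive samples all of whose words `(s, i)`, `i ∈ S`, satisfy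
local conditions met by at most `c` words each number at most `c^|S| · (A^d)^(2n - |S|)`
(independence of the `2n` words under `D₁`; Choudhury et al. 2026, proof of Lemma 21, "the `P_i`
are on disjoint sets of variables"). [cite: arXiv260723799, Lemma 21] -/
theorem card_filter_forall_side_le (s : Fin 2) (S : Finset (Fin n))
    (P : Fin n → (Fin d → Bool) → Bool) (c : ℕ)
    (hP : ∀ i ∈ S, #(univ.filter fun w : Fin d → Fin A => P i (bits w) = true) ≤ c) :
    #(univ.filter fun ω : PosΩ n d A => ∀ i ∈ S, P i (bits (ω (s, i))) = true) ≤
      c ^ #S * (A ^ d) ^ (2 * n - #S) := by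
  -- the box
  set p : Fin 2 × Fin n → Prop := fun k => k.1 = s ∧ k.2 ∈ S with hp
  set T : Fin 2 × Fin n → Finset (Fin d → Fin A) := fun k =>
    if p k then univ.filter (fun w : Fin d → Fin A => P k.2 (bits w) = true) else univ with hT
  have hsub : (univ.filter fun ω : PosΩ n d A => ∀ i ∈ S, P i (bits (ω (s, i))) = true) ⊆
      univ.filter fun ω : PosΩ n d A => ∀ k, ω k ∈ T k := by
    intro ω hω
    simp only [mem_filter, mem_univ, true_and] at hω ⊢
    rintro ⟨s', i⟩
    by_cases hk : p (s', i)
    · simp only [hT, hk, ↓reduceIte, mem_filter, mem_univ, true_and]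
      obtain ⟨rfl, hi⟩ := hk
      exact hω i hi
    · simp only [hT, hk, ↓reduceIte]
      exact mem_univ _
  refine (card_le_card hsub).trans ?_
  rw [card_filter_forall_mem T]
  -- evaluate the product
  have hTk : ∀ k, #(T k) = if p k then #(univ.filter fun w : Fin d → Fin A => P k.2 (bits w) = true)
      else A ^ d := by
    intro k
    simp only [hT]
    split_ifs
    · rfl
    · rw [card_univ, Fintype.card_fun, Fintype.card_fin, Fintype.card_fin]
  rw [Finset.prod_congr rfl (fun k _ => hTk k), prod_ite, prod_const]
  have hcardp : #(univ.filter fun k : Fin 2 × Fin n => p k) = #S := by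
    have : (univ.filter fun k : Fin 2 × Fin n => p k) = S.map ⟨fun i => (s, i), fun a b h => by
        simpa using h⟩ := by
      ext ⟨s', i⟩
      simp only [hp, mem_filter, mem_univ, true_and, mem_map, Function.Embedding.coeFn_mk,
        Prod.mk.injEq]
      constructor
      · rintro ⟨rfl, hi⟩
        exact ⟨i, hi, rfl, rfl⟩
      · rintro ⟨i', hi', rfl, rfl⟩
        exact ⟨rfl, hi'⟩
    rw [this, card_map]
  have hcardn : #(univ.filter fun k : Fin 2 × Fin n => ¬ p k) = 2 * n - #S := by
    have h := card_filter_add_card_filter_not (s := (univ : Finset (Fin 2 × Fin n))) p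
    rw [hcardp, card_univ, Fintype.card_prod, Fintype.card_fin, Fintype.card_fin] at h
    omega
  rw [hcardn]
  refine Nat.mul_le_mul_right _ ?_
  rw [← hcardp]
  exact prod_le_pow_card _ _ _ fun k hk => hP k.2 (mem_filter.1 hk).2.2

namespace Approx

variable (A : ℕ)

/-! #### The error set of an AND gate (Lemma 21) -/

/-- The positive samples accepted by both operands of an AND gate: when the merged index sets
overflow, the gate's approximator is set to `0` and exactly these samples may become new false
negatives (Choudhury et al. 2026, Lemma 21). [cite: arXiv260723799, Lemma 21] -/
def errAnd (F G : Approx n d) : Finset (PosΩ n d A) :=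
  univ.filter fun ω => F.eval (posInp ω) = true ∧ G.eval (posInp ω) = true

/-- **Lemma 21** (overflow on the `u`-side): if `|S_U^g ∪ S_U^h| > m`, then
`Pr_{D₁}[F̃_g ∧ F̃_h = 1] ≤ (1 - δ)^{m+1}`, in counting form. [cite: arXiv260723799, Lemma 21] -/
theorem card_errAnd_le_of_left {m φ : ℕ} {F G : Approx n d} (hF : F.Valid A m φ)
    (hG : G.Valid A m φ) (hover : m + 1 ≤ #(F.SU ∪ G.SU)) (hφ : φ ≤ A ^ d) :
    #(errAnd A F G) ≤ (A ^ d - φ) ^ (m + 1) * (A ^ d) ^ (2 * n - (m + 1)) := by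
  set S := F.SU ∪ G.SU with hS
  have hsub : errAnd A F G ⊆
      univ.filter fun ω : PosΩ n d A => ∀ i ∈ S, (F.and G).B i (bits (ω (0, i))) = true := by
    intro ω hω
    simp only [errAnd, mem_filter, mem_univ, true_and] at hω ⊢
    intro i hi
    have h := eval_and hF hG (posInp ω)
    rw [hω.1, hω.2, Bool.true_and, eval_eq_true_iff] at h
    exact h.1 i hi
  have hP : ∀ i ∈ S, #(univ.filter fun w : Fin d → Fin A => (F.and G).B i (bits w) = true) ≤
      A ^ d - φ := by
    intro i hi
    have h1 := thrB_and hF hG hi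
    have h2 := card_true_add_card_false (fun w : Fin d → Fin A => (F.and G).B i (bits w))
    omega
  have hSn : #S ≤ 2 * n := (card_le_univ S).trans (by rw [Fintype.card_fin]; omega)
  calc #(errAnd A F G) ≤ _ := card_le_card hsub
    _ ≤ (A ^ d - φ) ^ #S * (A ^ d) ^ (2 * n - #S) := card_filter_forall_side_le 0 S _ _ hP
    _ ≤ (A ^ d - φ) ^ (m + 1) * (A ^ d) ^ (2 * n - (m + 1)) :=
        pow_mul_pow_sub_antitone (Nat.sub_le _ _) hover hSn

/-- **Lemma 21** (overflow on the `v`-side). [cite: arXiv260723799, Lemma 21] -/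
theorem card_errAnd_le_of_right {m φ : ℕ} {F G : Approx n d} (hF : F.Valid A m φ)
    (hG : G.Valid A m φ) (hover : m + 1 ≤ #(F.SV ∪ G.SV)) (hφ : φ ≤ A ^ d) :
    #(errAnd A F G) ≤ (A ^ d - φ) ^ (m + 1) * (A ^ d) ^ (2 * n - (m + 1)) := by
  set S := F.SV ∪ G.SV with hS
  have hsub : errAnd A F G ⊆
      univ.filter fun ω : PosΩ n d A => ∀ j ∈ S, (F.and G).C j (bits (ω (1, j))) = true := by
    intro ω hω
    simp only [errAnd, mem_filter, mem_univ, true_and] at hω ⊢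
    intro j hj
    have h := eval_and hF hG (posInp ω)
    rw [hω.1, hω.2, Bool.true_and, eval_eq_true_iff] at h
    exact h.2 j hj
  have hP : ∀ j ∈ S, #(univ.filter fun w : Fin d → Fin A => (F.and G).C j (bits w) = true) ≤
      A ^ d - φ := by
    intro j hj
    have h1 := thrC_and hF hG hj
    have h2 := card_true_add_card_false (fun w : Fin d → Fin A => (F.and G).C j (bits w))
    omega
  have hSn : #S ≤ 2 * n := (card_le_univ S).trans (by rw [Fintype.card_fin]; omega)
  calc #(errAnd A F G) ≤ _ := card_le_card hsub
    _ ≤ (A ^ d - φ) ^ #S * (A ^ d) ^ (2 * n - #S) := card_filter_forall_side_le 1 S _ _ hP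
    _ ≤ (A ^ d - φ) ^ (m + 1) * (A ^ d) ^ (2 * n - (m + 1)) :=
        pow_mul_pow_sub_antitone (Nat.sub_le _ _) hover hSn

/-! #### The error set of an OR gate (Lemma 23) -/

/-- On a negative sample `(i, j, b)` a valid approximator can only fail through `B_i(b) = 0` or
`C_j(¬b) = 0` (all other vectors are all-ones and the local functions accept all-ones;
Choudhury et al. 2026, proof of Lemma 20). [cite: arXiv260723799, Lemma 20] -/
theorem eval_negInp_eq_false {m φ : ℕ} {F : Approx n d} (hF : F.Valid A m φ) (ω : NegΩ n d)
    (h : F.eval (negInp ω) = false) :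
    (ω.1 ∈ F.SU ∧ F.B ω.1 ω.2.2 = false) ∨ (ω.2.1 ∈ F.SV ∧ F.C ω.2.1 (fun t => !ω.2.2 t) = false) := by
  have h' : ¬ (F.eval (negInp ω) = true) := by rw [h]; exact Bool.false_ne_true
  rw [eval_eq_true_iff, not_and_or, not_forall, not_forall] at h'
  rcases h' with ⟨i, hi⟩ | ⟨j, hj⟩
  · rw [Classical.not_imp, Bool.not_eq_true, vecU_negInp] at hi
    left
    by_cases hi1 : i = ω.1
    · subst hi1
      rw [if_pos rfl] at hi
      exact hi
    · rw [if_neg hi1, hF.topB i] at hi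
      exact absurd hi.2 (by decide)
  · rw [Classical.not_imp, Bool.not_eq_true, vecV_negInp] at hj
    right
    by_cases hj1 : j = ω.2.1
    · subst hj1
      rw [if_pos rfl] at hj
      exact hj
    · rw [if_neg hj1, hF.topC j] at hj
      exact absurd hj.2 (by decide)

/-- The negative samples newly accepted at an OR gate: the gate's approximator accepts but both
operands reject (Choudhury et al. 2026, Lemma 23). [cite: arXiv260723799, Lemma 23] -/
def errOr (φ : ℕ) (F G : Approx n d) : Finset (NegΩ n d) :=
  univ.filter fun ω => (F.or A φ G).eval (negInp ω) = true ∧ F.eval (negInp ω) = false ∧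
    G.eval (negInp ω) = false

/-- The `u`-indices dropped at an OR gate for violating property 3. [cite: arXiv260723799, §4] -/
def dropU (φ : ℕ) (F G : Approx n d) : Finset (Fin n) :=
  (F.SU ∩ G.SU).filter fun i =>
    ¬ φ ≤ #(univ.filter fun w : Fin d → Fin A => (F.B i (bits w) || G.B i (bits w)) = false)

/-- The `v`-indices dropped at an OR gate for violating property 3. [cite: arXiv260723799, §4] -/
def dropV (φ : ℕ) (F G : Approx n d) : Finset (Fin n) :=
  (F.SV ∩ G.SV).filter fun j =>
    ¬ φ ≤ #(univ.filter fun w : Fin d → Fin A => (F.C j (bits w) || G.C j (bits w)) = false)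

/-- **Case analysis of Lemma 23.** A newly accepted negative sample `(i, j, b)` has its planted
pair meeting both operands (`i ∈ S_U^g, j ∈ S_V^h` or symmetrically: cases 1(b)), or its planted
index carries a dropped local clause that rejects `b` (case 2). [cite: arXiv260723799, Lemma 23] -/
theorem errOr_subset {m φ : ℕ} {F G : Approx n d} (hF : F.Valid A m φ) (hG : G.Valid A m φ) :
    errOr A φ F G ⊆
      (F.SU ×ˢ (G.SV ×ˢ (univ : Finset (Fin d → Bool)))) ∪
      (G.SU ×ˢ (F.SV ×ˢ (univ : Finset (Fin d → Bool)))) ∪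
      (univ.filter fun ω : NegΩ n d =>
        ω.1 ∈ dropU A φ F G ∧ (F.B ω.1 ω.2.2 || G.B ω.1 ω.2.2) = false) ∪
      (univ.filter fun ω : NegΩ n d =>
        ω.2.1 ∈ dropV A φ F G ∧ (F.C ω.2.1 (fun t => !ω.2.2 t) || G.C ω.2.1 (fun t => !ω.2.2 t)) = false) := by
  intro ω hω
  simp only [errOr, mem_filter, mem_univ, true_and] at hω
  obtain ⟨hor, hFω, hGω⟩ := hω
  have hor' := (eval_eq_true_iff _ _).1 hor
  simp only [mem_union, mem_product, mem_univ, and_true, mem_filter, true_and]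
  rcases eval_negInp_eq_false A hF ω hFω with ⟨hiF, hBF⟩ | ⟨hjF, hCF⟩ <;>
    rcases eval_negInp_eq_false A hG ω hGω with ⟨hiG, hBG⟩ | ⟨hjG, hCG⟩
  · -- case 2 on the `u`-side
    left; right
    have hval : (F.B ω.1 ω.2.2 || G.B ω.1 ω.2.2) = false := by simp [hBF, hBG]
    refine ⟨mem_filter.2 ⟨mem_inter.2 ⟨hiF, hiG⟩, fun hthr => ?_⟩, hval⟩
    have hmem : ω.1 ∈ orSU A φ F G := mem_filter.2 ⟨mem_inter.2 ⟨hiF, hiG⟩, hthr⟩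
    have h := hor'.1 ω.1 hmem
    simp only [or] at h
    rw [if_pos hmem, vecU_negInp, if_pos rfl, hval] at h
    exact Bool.false_ne_true h
  · -- case 1(b)
    left; left; left
    exact ⟨hiF, hjG⟩
  · -- case 1(b), symmetric
    left; left; right
    exact ⟨hiG, hjF⟩
  · -- case 2 on the `v`-side
    right
    have hval : (F.C ω.2.1 (fun t => !ω.2.2 t) || G.C ω.2.1 (fun t => !ω.2.2 t)) = false := by
      simp [hCF, hCG]
    refine ⟨mem_filter.2 ⟨mem_inter.2 ⟨hjF, hjG⟩, fun hthr => ?_⟩, hval⟩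
    have hmem : ω.2.1 ∈ orSV A φ F G := mem_filter.2 ⟨mem_inter.2 ⟨hjF, hjG⟩, hthr⟩
    have h := hor'.2 ω.2.1 hmem
    simp only [or] at h
    rw [if_pos hmem, vecV_negInp, if_pos rfl, hval] at h
    exact Bool.false_ne_true h

/-- Complementing the planted vector is a bijection: `#{b | X(¬b) = 0} = #{b | X(b) = 0}`
(the symmetry between `u_i = b` and `v_j = ¬b` under `D₀`). [folklore] -/
theorem card_filter_compl_eq (X : (Fin d → Bool) → Bool) :
    #(univ.filter fun b : Fin d → Bool => X (fun t => !b t) = false) =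
      #(univ.filter fun b : Fin d → Bool => X b = false) := by
  refine card_equiv (Equiv.mk (fun b : Fin d → Bool => fun t => !b t) (fun b t => !b t)
    (fun b => by simp) (fun b => by simp)) fun b => ?_
  simp

/-- **Case 2 of Lemma 23, `u`-side**: the negative samples whose planted `u`-index carries a
dropped clause rejecting `b` are few, by the coupling lemma (Lemma 22): each dropped clause has
`Pr_{μ_{1/A}}[X = 0] < δ`, hence `Pr_{b}[X(b) = 0] ≤ δ^K`; counting form, multiplied through by
`#H^d`. [cite: arXiv260723799, Lemma 23] -/
theorem card_dropU_mul_le {K m φ : ℕ} {F G : Approx n d} (hF : F.Valid A m φ) (hG : G.Valid A m φ)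
    (H : Finset (Fin K → Fin A)) (hZ : ∀ v : Fin K → Fin A, (∃ k, (v k : ℕ) = 0) → v ∈ H)
    (hH : #Hᶜ = #H) :
    #(univ.filter fun ω : NegΩ n d =>
        ω.1 ∈ dropU A φ F G ∧ (F.B ω.1 ω.2.2 || G.B ω.1 ω.2.2) = false) * #H ^ d ≤
      m * (n * φ ^ K) := by
  set X : Fin n → (Fin d → Bool) → Bool := fun i b => F.B i b || G.B i b with hX
  have hsub : (univ.filter fun ω : NegΩ n d =>
      ω.1 ∈ dropU A φ F G ∧ (F.B ω.1 ω.2.2 || G.B ω.1 ω.2.2) = false) ⊆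
      (dropU A φ F G).biUnion fun i =>
        ({i} : Finset (Fin n)) ×ˢ ((univ : Finset (Fin n)) ×ˢ
          (univ.filter fun b : Fin d → Bool => X i b = false)) := by
    intro ω hω
    simp only [mem_filter, mem_univ, true_and] at hω
    simp only [mem_biUnion, mem_product, mem_singleton, mem_univ, true_and, mem_filter]
    exact ⟨ω.1, hω.1, rfl, hω.2⟩
  have hdrop : #(dropU A φ F G) ≤ m :=
    (card_le_card ((filter_subset _ _).trans inter_subset_left)).trans hF.cardU
  calc _ ≤ #((dropU A φ F G).biUnion fun i => ({i} : Finset (Fin n)) ×ˢ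
          ((univ : Finset (Fin n)) ×ˢ (univ.filter fun b : Fin d → Bool => X i b = false))) * #H ^ d :=
        Nat.mul_le_mul_right _ (card_le_card hsub)
    _ ≤ (∑ i ∈ dropU A φ F G, #(({i} : Finset (Fin n)) ×ˢ
          ((univ : Finset (Fin n)) ×ˢ (univ.filter fun b : Fin d → Bool => X i b = false)))) * #H ^ d :=
        Nat.mul_le_mul_right _ card_biUnion_le
    _ = ∑ i ∈ dropU A φ F G, n * (#(univ.filter fun b : Fin d → Bool => X i b = false) * #H ^ d) := by
        rw [sum_mul]
        refine sum_congr rfl fun i _ => ?_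
        rw [card_product, card_product, card_singleton, card_univ, Fintype.card_fin]
        ring
    _ ≤ ∑ i ∈ dropU A φ F G, n * φ ^ K := by
        refine sum_le_sum fun i hi => Nat.mul_le_mul_left _ ?_
        have hmono : Monotone (X i) := monotone_or (hF.monoB i) (hG.monoB i)
        refine (card_false_mul_le_pow (X i) hmono H hZ hH).trans (Nat.pow_le_pow_left ?_ K)
        have h := (mem_filter.1 hi).2
        simp only [hX, not_le] at h ⊢
        exact h.le
    _ ≤ m * (n * φ ^ K) := by
        rw [sum_const, smul_eq_mul]
        exact Nat.mul_le_mul_right _ hdrop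

/-- **Case 2 of Lemma 23, `v`-side** (with the complemented planted vector).
[cite: arXiv260723799, Lemma 23] -/
theorem card_dropV_mul_le {K m φ : ℕ} {F G : Approx n d} (hF : F.Valid A m φ) (hG : G.Valid A m φ)
    (H : Finset (Fin K → Fin A)) (hZ : ∀ v : Fin K → Fin A, (∃ k, (v k : ℕ) = 0) → v ∈ H)
    (hH : #Hᶜ = #H) :
    #(univ.filter fun ω : NegΩ n d =>
        ω.2.1 ∈ dropV A φ F G ∧
          (F.C ω.2.1 (fun t => !ω.2.2 t) || G.C ω.2.1 (fun t => !ω.2.2 t)) = false) * #H ^ d ≤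
      m * (n * φ ^ K) := by
  set X : Fin n → (Fin d → Bool) → Bool := fun j b => F.C j b || G.C j b with hX
  have hsub : (univ.filter fun ω : NegΩ n d =>
      ω.2.1 ∈ dropV A φ F G ∧
        (F.C ω.2.1 (fun t => !ω.2.2 t) || G.C ω.2.1 (fun t => !ω.2.2 t)) = false) ⊆
      (dropV A φ F G).biUnion fun j =>
        (univ : Finset (Fin n)) ×ˢ (({j} : Finset (Fin n)) ×ˢ
          (univ.filter fun b : Fin d → Bool => X j (fun t => !b t) = false)) := by
    intro ω hω
    simp only [mem_filter, mem_univ, true_and] at hω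
    simp only [mem_biUnion, mem_product, mem_singleton, mem_univ, true_and, mem_filter]
    exact ⟨ω.2.1, hω.1, rfl, hω.2⟩
  have hdrop : #(dropV A φ F G) ≤ m :=
    (card_le_card ((filter_subset _ _).trans inter_subset_left)).trans hF.cardV
  calc _ ≤ #((dropV A φ F G).biUnion fun j => (univ : Finset (Fin n)) ×ˢ (({j} : Finset (Fin n)) ×ˢ
          (univ.filter fun b : Fin d → Bool => X j (fun t => !b t) = false))) * #H ^ d :=
        Nat.mul_le_mul_right _ (card_le_card hsub)
    _ ≤ (∑ j ∈ dropV A φ F G, #((univ : Finset (Fin n)) ×ˢ (({j} : Finset (Fin n)) ×ˢ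
          (univ.filter fun b : Fin d → Bool => X j (fun t => !b t) = false)))) * #H ^ d :=
        Nat.mul_le_mul_right _ card_biUnion_le
    _ = ∑ j ∈ dropV A φ F G, n * (#(univ.filter fun b : Fin d → Bool => X j b = false) * #H ^ d) := by
        rw [sum_mul]
        refine sum_congr rfl fun j _ => ?_
        rw [card_product, card_product, card_singleton, card_univ, Fintype.card_fin,
          card_filter_compl_eq]
        ring
    _ ≤ ∑ j ∈ dropV A φ F G, n * φ ^ K := by
        refine sum_le_sum fun j hj => Nat.mul_le_mul_left _ ?_
        have hmono : Monotone (X j) := monotone_or (hF.monoC j) (hG.monoC j)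
        refine (card_false_mul_le_pow (X j) hmono H hZ hH).trans (Nat.pow_le_pow_left ?_ K)
        have h := (mem_filter.1 hj).2
        simp only [hX, not_le] at h ⊢
        exact h.le
    _ ≤ m * (n * φ ^ K) := by
        rw [sum_const, smul_eq_mul]
        exact Nat.mul_le_mul_right _ hdrop

/-- **Lemma 23** (errors at OR gates), counting form multiplied through by `#H^d`
(`2^d · #H^d = A^{Kd}`): `Pr_{D₀}[F̃_{g∨h} ≠ F̃_g ∨ F̃_h] ≤ 2m²/n² + 2m δ^K/n`.
[cite: arXiv260723799, Lemma 23] -/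
theorem card_errOr_mul_le {K m φ : ℕ} {F G : Approx n d} (hF : F.Valid A m φ) (hG : G.Valid A m φ)
    (H : Finset (Fin K → Fin A)) (hZ : ∀ v : Fin K → Fin A, (∃ k, (v k : ℕ) = 0) → v ∈ H)
    (hH : #Hᶜ = #H) :
    #(errOr A φ F G) * #H ^ d ≤ 2 * (m * m * 2 ^ d) * #H ^ d + 2 * (m * (n * φ ^ K)) := by
  have h1 : #(F.SU ×ˢ (G.SV ×ˢ (univ : Finset (Fin d → Bool)))) ≤ m * m * 2 ^ d := by
    rw [card_product, card_product, card_univ, card_boolVec, ← mul_assoc]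
    exact Nat.mul_le_mul_right _ (Nat.mul_le_mul hF.cardU hG.cardV)
  have h2 : #(G.SU ×ˢ (F.SV ×ˢ (univ : Finset (Fin d → Bool)))) ≤ m * m * 2 ^ d := by
    rw [card_product, card_product, card_univ, card_boolVec, ← mul_assoc]
    exact Nat.mul_le_mul_right _ (Nat.mul_le_mul hG.cardU hF.cardV)
  have h3 := card_dropU_mul_le A hF hG H hZ hH
  have h4 := card_dropV_mul_le A hF hG H hZ hH
  have hsub := errOr_subset A hF hG (φ := φ)
  have hc := (card_le_card hsub).trans ((card_union_le _ _).trans (Nat.add_le_add_right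
    ((card_union_le _ _).trans (Nat.add_le_add_right (card_union_le _ _) _)) _))
  have := Nat.mul_le_mul_right (#H ^ d) hc
  nlinarith [this, h1, h2, h3, h4, Nat.zero_le (#H ^ d)]

/-! #### Lemma 20: a non-zero approximator rejects few negative samples -/

/-- **Lemma 20.** A valid (non-zero) approximator rejects a negative sample `(i, j, b)` only if
`i ∈ S_U` or `j ∈ S_V`: at most `(|S_U| + |S_V|) · n · 2^d` of the `n² 2^d` samples, i.e.
`Pr_{D₀}[F̃ = 0] ≤ 2m/n`. [cite: arXiv260723799, Lemma 20] -/
theorem card_filter_eval_negInp_false_le {m φ : ℕ} {F : Approx n d} (hF : F.Valid A m φ) :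
    #(univ.filter fun ω : NegΩ n d => F.eval (negInp ω) = false) ≤ (#F.SU + #F.SV) * (n * 2 ^ d) := by
  have hsub : (univ.filter fun ω : NegΩ n d => F.eval (negInp ω) = false) ⊆
      (F.SU ×ˢ ((univ : Finset (Fin n)) ×ˢ (univ : Finset (Fin d → Bool)))) ∪
      ((univ : Finset (Fin n)) ×ˢ (F.SV ×ˢ (univ : Finset (Fin d → Bool)))) := by
    intro ω hω
    simp only [mem_filter, mem_univ, true_and] at hω
    simp only [mem_union, mem_product, mem_univ, and_true, true_and]
    rcases eval_negInp_eq_false A hF ω hω with h | h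
    · exact Or.inl h.1
    · exact Or.inr h.1
  refine (card_le_card hsub).trans ((card_union_le _ _).trans (le_of_eq ?_))
  rw [card_product, card_product, card_product, card_product, card_univ, card_univ,
    Fintype.card_fin, card_boolVec]
  ring

end Approx

/-! ### Lemma 17: `D₁` is concentrated on `1`-inputs -/

/-- For fixed `i, j`, the number of positive samples with `u_i ⊥ v_j` is
`((A² - 1) · A^(2n-2))^d` (`Pr[u_i ⊥ v_j] = (1 - p²)^d` with `p = 1/A`; Choudhury et al. 2026,
proof of Lemma 17). [cite: arXiv260723799, Lemma 17] -/
theorem card_filter_orthogonal (hA : 1 ≤ A) (i j : Fin n) :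
    #(univ.filter fun ω : PosΩ n d A =>
        Cryptography.AreOrthogonal (bits (ω (0, i))) (bits (ω (1, j)))) =
      ((A ^ 2 - 1) * A ^ (2 * n - 2)) ^ d := by
  -- the admissible columns
  set Q : Finset (Fin 2 × Fin n → Fin A) :=
    univ.filter fun q => ¬ (((q (0, i) : ℕ) = 0) ∧ ((q (1, j) : ℕ) = 0)) with hQ
  have hcol := card_filter_forall_col (ι := Fin 2 × Fin n) (κ := Fin d) (α := Fin A) (fun _ => Q)
  rw [prod_const, card_univ, Fintype.card_fin] at hcol
  -- `#Q = A^{2n} - A^{2n-2}`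
  have hQ' : #((univ : Finset (Fin 2 × Fin n → Fin A)).filter fun q =>
      ((q (0, i) : ℕ) = 0) ∧ ((q (1, j) : ℕ) = 0)) = A ^ (2 * n - 2) := by
    set Z : Finset (Fin A) := univ.filter fun a : Fin A => (a : ℕ) = 0 with hZ
    have hZ1 : #Z = 1 := by
      rw [card_eq_one]
      refine ⟨⟨0, by omega⟩, ?_⟩
      ext a
      simp [hZ, Fin.ext_iff]
    set p : Fin 2 × Fin n → Prop := fun k => k = (0, i) ∨ k = (1, j) with hp
    have hbox := card_filter_forall_mem (ι := Fin 2 × Fin n) (fun k => if p k then Z else univ)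
    have hTk : ∀ k, #(if p k then Z else (univ : Finset (Fin A))) = if p k then 1 else A := by
      intro k
      split_ifs
      · exact hZ1
      · rw [card_univ, Fintype.card_fin]
    rw [Finset.prod_congr rfl (fun k _ => hTk k), prod_ite, prod_const_one, one_mul, prod_const]
      at hbox
    have hcp : #(univ.filter fun k : Fin 2 × Fin n => p k) = 2 := by
      have : (univ.filter fun k : Fin 2 × Fin n => p k) = {(0, i), (1, j)} := by
        ext k
        simp [hp]
      rw [this, card_pair]
      simp
    have hcn : #(univ.filter fun k : Fin 2 × Fin n => ¬ p k) = 2 * n - 2 := by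
      have h := card_filter_add_card_filter_not (s := (univ : Finset (Fin 2 × Fin n))) p
      rw [hcp, card_univ, Fintype.card_prod, Fintype.card_fin, Fintype.card_fin] at h
      omega
    rw [hcn] at hbox
    rw [← hbox]
    congr 1
    ext q
    simp only [mem_filter, mem_univ, true_and, hZ, hp]
    constructor
    · rintro ⟨h0, h1⟩ k
      split_ifs with hk
      · rcases hk with rfl | rfl
        · simpa using h0
        · simpa using h1
      · exact mem_univ _
    · intro h
      have h0 := h (0, i)
      have h1 := h (1, j)
      simp only [true_or, ↓reduceIte, or_true, mem_filter, mem_univ, true_and] at h0 h1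
      exact ⟨h0, h1⟩
  have hQcard : #Q = (A ^ 2 - 1) * A ^ (2 * n - 2) := by
    have h := card_filter_add_card_filter_not (s := (univ : Finset (Fin 2 × Fin n → Fin A)))
      (fun q => ((q (0, i) : ℕ) = 0) ∧ ((q (1, j) : ℕ) = 0))
    rw [hQ', card_univ, Fintype.card_fun, Fintype.card_prod, Fintype.card_fin, Fintype.card_fin,
      Fintype.card_fin] at h
    have hn : 1 ≤ n := Nat.one_le_iff_ne_zero.2 (fun h0 => by subst h0; exact i.elim0)
    have hpow : A ^ (2 * n) = A ^ 2 * A ^ (2 * n - 2) := by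
      rw [← pow_add]; congr 1; omega
    rw [hQ]
    rw [hpow] at h
    have : #Q = A ^ 2 * A ^ (2 * n - 2) - A ^ (2 * n - 2) := by rw [hQ]; omega
    rw [hQ] at this
    rw [this, Nat.sub_mul, one_mul]
  rw [hQcard] at hcol
  rw [← hcol]
  congr 1
  ext ω
  simp only [mem_filter, mem_univ, true_and, Cryptography.AreOrthogonal, bits_apply,
    decide_eq_true_eq, hQ]

/-- **Lemma 17** (counting form): at most `n² · ((A² - 1) A^(2n-2))^d` of the `A^{2nd}` positive
samples encode a `0`-input of `¬OV_{n,d}`, i.e. `Pr_{D₁}[Int_{n,d} = 0] ≤ n² (1 - p²)^d`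
(union bound over the `n²` pairs). [cite: arXiv260723799, Lemma 17] -/
theorem card_filter_notOVFn_posInp_false_le (hA : 1 ≤ A) :
    #(univ.filter fun ω : PosΩ n d A => Cryptography.notOVFn n d (posInp ω) = false) ≤
      n ^ 2 * ((A ^ 2 - 1) * A ^ (2 * n - 2)) ^ d := by
  have hsub : (univ.filter fun ω : PosΩ n d A => Cryptography.notOVFn n d (posInp ω) = false) ⊆
      (univ : Finset (Fin n × Fin n)).biUnion fun ij => univ.filter fun ω : PosΩ n d A =>
        Cryptography.AreOrthogonal (bits (ω (0, ij.1))) (bits (ω (1, ij.2))) := by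
    intro ω hω
    simp only [mem_filter, mem_univ, true_and, notOVFn_eq_false_iff, vecU_posInp, vecV_posInp] at hω
    obtain ⟨i, j, h⟩ := hω
    simp only [mem_biUnion, mem_univ, true_and, mem_filter]
    exact ⟨(i, j), h⟩
  refine (card_le_card hsub).trans (card_biUnion_le.trans ?_)
  rw [Finset.sum_congr rfl (fun ij _ => card_filter_orthogonal hA ij.1 ij.2), sum_const,
    smul_eq_mul, card_univ, Fintype.card_prod, Fintype.card_fin]
  exact le_of_eq (by ring)


/-! ### Approximators of wires and the two gate steps -/

/-- The Boolean function of a possibly-zero approximator (`none` is the constant `0`).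
[cite: arXiv260723799, Definition 19] -/
def evalO : Option (Approx n d) → (Idx n d → Bool) → Bool
  | none, _ => false
  | some F, x => F.eval x

/-- The approximator of an AND gate: the conjunction if property 2 survives, else the constant `0`;
`0 ∧ F = 0` (Choudhury et al. 2026, §4, case `g ∧ h`). [cite: arXiv260723799, §4] -/
def andO (m : ℕ) : Option (Approx n d) → Option (Approx n d) → Option (Approx n d)
  | some F, some G => if #(F.SU ∪ G.SU) ≤ m ∧ #(F.SV ∪ G.SV) ≤ m then some (F.and G) else none
  | _, _ => none

/-- The approximator of an OR gate; `0 ∨ F = F` (Choudhury et al. 2026, §4, case `g ∨ h`).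
[cite: arXiv260723799, §4] -/
def orO (A φ : ℕ) : Option (Approx n d) → Option (Approx n d) → Option (Approx n d)
  | some F, some G => some (F.or A φ G)
  | some F, none => some F
  | none, G => G

/-- The new false negatives of an AND gate (empty unless property 2 overflows).
[cite: arXiv260723799, Lemma 21] -/
def errAndO (A m : ℕ) : Option (Approx n d) → Option (Approx n d) → Finset (PosΩ n d A)
  | some F, some G => if #(F.SU ∪ G.SU) ≤ m ∧ #(F.SV ∪ G.SV) ≤ m then ∅ else Approx.errAnd A F G
  | _, _ => ∅

/-- The new false positives of an OR gate. [cite: arXiv260723799, Lemma 23] -/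
def errOrO (A φ : ℕ) : Option (Approx n d) → Option (Approx n d) → Finset (NegΩ n d)
  | some F, some G => Approx.errOr A φ F G
  | _, _ => ∅

/-- The invariant of the approximator `F` of a wire computing `v`, relative to global sets of
*false negatives* `BadP ⊆ supp D₁` and *false positives* `BadN ⊆ supp D₀`: `F` is valid, every
positive sample accepted by the wire is accepted by `F` or bad, and every negative sample accepted
by `F` is accepted by the wire or bad (the one-sided bookkeeping of the approximation method,
Choudhury et al. 2026, §4, "Error bounds"; cf. `RApprox` of the tree's Razborov proof).
[cite: arXiv260723799, §4] -/
structure IsApprox (A m φ : ℕ) (BadP : Finset (PosΩ n d A)) (BadN : Finset (NegΩ n d))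
    (F : Option (Approx n d)) (v : (Idx n d → Bool) → Bool) : Prop where
  /-- the approximator is valid -/
  valid : ∀ F', F = some F' → F'.Valid A m φ
  /-- accepted positive samples are accepted by the approximator, or bad -/
  pos : ∀ ω, v (posInp ω) = true → evalO F (posInp ω) = true ∨ ω ∈ BadP
  /-- negative samples accepted by the approximator are accepted by the wire, or bad -/
  neg : ∀ ω, evalO F (negInp ω) = true → v (negInp ω) = true ∨ ω ∈ BadN

namespace IsApprox

variable {m φ : ℕ} {BadP BadP' : Finset (PosΩ n d A)} {BadN BadN' : Finset (NegΩ n d)}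
  {F G : Option (Approx n d)} {v v' u w : (Idx n d → Bool) → Bool}

/-- Enlarging the bad sets preserves the invariant. [folklore] -/
theorem mono (h : IsApprox A m φ BadP BadN F v) (hP : BadP ⊆ BadP') (hN : BadN ⊆ BadN') :
    IsApprox A m φ BadP' BadN' F v where
  valid := h.valid
  pos ω hω := (h.pos ω hω).imp_right fun hb => hP hb
  neg ω hω := (h.neg ω hω).imp_right fun hb => hN hb

/-- Extensionality in the approximated function. [folklore] -/
theorem congr (h : IsApprox A m φ BadP BadN F v) (hv : ∀ x, v x = v' x) :
    IsApprox A m φ BadP BadN F v' where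
  valid := h.valid
  pos ω hω := h.pos ω ((hv _).trans hω)
  neg ω hω := (h.neg ω hω).imp_left fun h' => (hv _).symm.trans h'

/-- **Leaves** make no error (Choudhury et al. 2026, §4, "Leaves"). [cite: arXiv260723799, §4] -/
theorem leaf (hA : 1 ≤ A) (hm : 1 ≤ m) (hφ : φ ≤ (A - 1) * A ^ (d - 1)) (i : Idx n d) :
    IsApprox A m φ BadP BadN (some (Approx.leaf i)) (fun x => x i) where
  valid F' hF' := by cases hF'; exact Approx.valid_leaf hA hm hφ i
  pos ω hω := Or.inl (by simp only [evalO, Approx.eval_leaf]; exact hω)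
  neg ω hω := Or.inl (by simp only [evalO, Approx.eval_leaf] at hω; exact hω)

/-- **AND gates** (Choudhury et al. 2026, §4 and Lemma 21): no new false positives; the new
false negatives are `errAndO`. [cite: arXiv260723799, Lemma 21] -/
theorem and_gate (hu : IsApprox A m φ BadP BadN F u) (hw : IsApprox A m φ BadP BadN G w) :
    IsApprox A m φ (BadP ∪ errAndO A m F G) BadN (andO m F G) (fun x => u x && w x) := by
  rcases F with _ | F <;> rcases G with _ | G
  · refine ⟨fun F' h => (by cases h), fun ω hω => ?_, fun ω hω => (by simp [evalO, andO] at hω)⟩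
    rw [Bool.and_eq_true] at hω
    rcases hu.pos ω hω.1 with h | h
    · simp [evalO] at h
    · exact Or.inr (mem_union_left _ h)
  · refine ⟨fun F' h => (by cases h), fun ω hω => ?_, fun ω hω => (by simp [evalO, andO] at hω)⟩
    rw [Bool.and_eq_true] at hω
    rcases hu.pos ω hω.1 with h | h
    · simp [evalO] at h
    · exact Or.inr (mem_union_left _ h)
  · refine ⟨fun F' h => (by cases h), fun ω hω => ?_, fun ω hω => (by simp [evalO, andO] at hω)⟩
    rw [Bool.and_eq_true] at hω
    rcases hw.pos ω hω.2 with h | h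
    · simp [evalO] at h
    · exact Or.inr (mem_union_left _ h)
  · have hF := hu.valid F rfl
    have hG := hw.valid G rfl
    by_cases hc : #(F.SU ∪ G.SU) ≤ m ∧ #(F.SV ∪ G.SV) ≤ m
    · have handO : andO m (some F) (some G) = some (F.and G) := by simp [andO, hc]
      rw [handO]
      refine ⟨fun F' h => (by cases h; exact Approx.valid_and hF hG hc.1 hc.2), fun ω hω => ?_,
        fun ω hω => ?_⟩
      · rw [Bool.and_eq_true] at hω
        rcases hu.pos ω hω.1 with h1 | h1
        · rcases hw.pos ω hω.2 with h2 | h2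
          · left
            simp only [evalO] at h1 h2 ⊢
            rw [Approx.eval_and hF hG, h1, h2, Bool.true_and]
          · exact Or.inr (mem_union_left _ h2)
        · exact Or.inr (mem_union_left _ h1)
      · simp only [evalO] at hω
        rw [Approx.eval_and hF hG, Bool.and_eq_true] at hω
        rcases hu.neg ω hω.1 with h1 | h1
        · rcases hw.neg ω hω.2 with h2 | h2
          · left
            rw [h1, h2, Bool.true_and]
          · exact Or.inr h2
        · exact Or.inr h1
    · have handO : andO m (some F) (some G) = none := by simp [andO, hc]
      have herr : errAndO A m (some F) (some G) = Approx.errAnd A F G := by simp [errAndO, hc]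
      rw [handO, herr]
      refine ⟨fun F' h => (by cases h), fun ω hω => ?_, fun ω hω => (by simp [evalO] at hω)⟩
      rw [Bool.and_eq_true] at hω
      rcases hu.pos ω hω.1 with h1 | h1
      · rcases hw.pos ω hω.2 with h2 | h2
        · right
          simp only [evalO] at h1 h2
          exact mem_union_right _ (mem_filter.2 ⟨mem_univ _, h1, h2⟩)
        · exact Or.inr (mem_union_left _ h2)
      · exact Or.inr (mem_union_left _ h1)

/-- **OR gates** (Choudhury et al. 2026, §4 and Lemma 23): no new false negatives; the new
false positives are `errOrO`. [cite: arXiv260723799, Lemma 23] -/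
theorem or_gate (hu : IsApprox A m φ BadP BadN F u) (hw : IsApprox A m φ BadP BadN G w) :
    IsApprox A m φ BadP (BadN ∪ errOrO A φ F G) (orO A φ F G) (fun x => u x || w x) := by
  rcases F with _ | F <;> rcases G with _ | G
  · refine ⟨fun F' h => (by cases h), fun ω hω => ?_, fun ω hω => (by simp [evalO, orO] at hω)⟩
    rw [Bool.or_eq_true] at hω
    rcases hω with hω | hω
    · rcases hu.pos ω hω with h | h
      · simp [evalO] at h
      · exact Or.inr h
    · rcases hw.pos ω hω with h | h
      · simp [evalO] at h
      · exact Or.inr h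
  · -- `0 ∨ G = G`
    refine ⟨fun F' h => hw.valid F' (by simpa [orO] using h), fun ω hω => ?_, fun ω hω => ?_⟩
    · rw [Bool.or_eq_true] at hω
      rcases hω with hω | hω
      · rcases hu.pos ω hω with h | h
        · simp [evalO] at h
        · exact Or.inr h
      · simpa [orO] using hw.pos ω hω
    · simp only [orO] at hω
      rcases hw.neg ω hω with h | h
      · left
        rw [h, Bool.or_true]
      · exact Or.inr (mem_union_left _ h)
  · -- `F ∨ 0 = F`
    refine ⟨fun F' h => hu.valid F' (by simpa [orO] using h), fun ω hω => ?_, fun ω hω => ?_⟩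
    · rw [Bool.or_eq_true] at hω
      rcases hω with hω | hω
      · simpa [orO] using hu.pos ω hω
      · rcases hw.pos ω hω with h | h
        · simp [evalO] at h
        · exact Or.inr h
    · simp only [orO] at hω
      rcases hu.neg ω hω with h | h
      · left
        rw [h, Bool.true_or]
      · exact Or.inr (mem_union_left _ h)
  · have hF := hu.valid F rfl
    have hG := hw.valid G rfl
    simp only [orO, errOrO]
    refine ⟨fun F' h => (by cases h; exact Approx.valid_or hF hG), fun ω hω => ?_, fun ω hω => ?_⟩
    · rw [Bool.or_eq_true] at hω
      rcases hω with hω | hω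
      · rcases hu.pos ω hω with h | h
        · left
          simp only [evalO] at h ⊢
          exact Approx.eval_or_of_left A φ G h
        · exact Or.inr h
      · rcases hw.pos ω hω with h | h
        · left
          simp only [evalO] at h ⊢
          exact Approx.eval_or_of_right A φ F h
        · exact Or.inr h
    · simp only [evalO] at hω
      cases hFω : F.eval (negInp ω)
      · cases hGω : G.eval (negInp ω)
        · exact Or.inr (mem_union_right _ (mem_filter.2 ⟨mem_univ _, hω, hFω, hGω⟩))
        · rcases hw.neg ω hGω with h | h
          · left
            rw [h, Bool.or_true]
          · exact Or.inr (mem_union_left _ h)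
      · rcases hu.neg ω hFω with h | h
        · left
          rw [h, Bool.true_or]
        · exact Or.inr (mem_union_left _ h)

end IsApprox

/-- The per-gate bound on new false negatives (Lemma 21). [cite: arXiv260723799, Lemma 21] -/
theorem card_errAndO_le {m φ : ℕ} {BadP : Finset (PosΩ n d A)} {BadN : Finset (NegΩ n d)}
    {F G : Option (Approx n d)} {u w : (Idx n d → Bool) → Bool}
    (hu : IsApprox A m φ BadP BadN F u) (hw : IsApprox A m φ BadP BadN G w) (hφ : φ ≤ A ^ d) :
    #(errAndO A m F G) ≤ (A ^ d - φ) ^ (m + 1) * (A ^ d) ^ (2 * n - (m + 1)) := by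
  rcases F with _ | F <;> rcases G with _ | G
  · simp [errAndO]
  · simp [errAndO]
  · simp [errAndO]
  · have hF := hu.valid F rfl
    have hG := hw.valid G rfl
    simp only [errAndO]
    split_ifs with hc
    · simp
    · rw [not_and_or, not_le, not_le] at hc
      rcases hc with hc | hc
      · exact Approx.card_errAnd_le_of_left A hF hG hc hφ
      · exact Approx.card_errAnd_le_of_right A hF hG hc hφ

/-- The per-gate bound on new false positives (Lemma 23). [cite: arXiv260723799, Lemma 23] -/
theorem card_errOrO_mul_le {K m φ : ℕ} {BadP : Finset (PosΩ n d A)} {BadN : Finset (NegΩ n d)}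
    {F G : Option (Approx n d)} {u w : (Idx n d → Bool) → Bool}
    (hu : IsApprox A m φ BadP BadN F u) (hw : IsApprox A m φ BadP BadN G w)
    (H : Finset (Fin K → Fin A)) (hZ : ∀ v : Fin K → Fin A, (∃ k, (v k : ℕ) = 0) → v ∈ H)
    (hH : #Hᶜ = #H) :
    #(errOrO A φ F G) * #H ^ d ≤ 2 * (m * m * 2 ^ d) * #H ^ d + 2 * (m * (n * φ ^ K)) := by
  rcases F with _ | F <;> rcases G with _ | G
  · simp [errOrO]
  · simp [errOrO]
  · simp [errOrO]
  · exact Approx.card_errOr_mul_le A (hu.valid F rfl) (hw.valid G rfl) H hZ hH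

/-! ### The approximation method along a monotone straight-line program -/

open Complexity Complexity.GateList

/-- **Approximators along a monotone program** (Choudhury et al. 2026, §4, "Constructing an
`(m, δ)`-approximator" together with Lemmas 21 and 23 and the union bound (3)–(4) of the proof of
Theorem 5): along a well-formed program over `{∧₂, ∨₂}` on the inputs of `¬OV_{n,d}`, every wire
receives an approximator satisfying `IsApprox` relative to global bad sets with
`#BadP ≤ #gates · (A^d - φ)^{m+1} (A^d)^{2n-m-1}` and
`#BadN · #H^d ≤ #gates · (2 m² 2^d #H^d + 2 m n φ^K)`. [cite: arXiv260723799, Theorem 5] -/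
theorem exists_isApprox_gates {K m φ : ℕ} (hA : 1 ≤ A) (hm : 1 ≤ m)
    (hφ1 : φ ≤ (A - 1) * A ^ (d - 1)) (hφ2 : φ ≤ A ^ d)
    (H : Finset (Fin K → Fin A)) (hZ : ∀ v : Fin K → Fin A, (∃ k, (v k : ℕ) = 0) → v ∈ H)
    (hH : #Hᶜ = #H) :
    ∀ gs : List (Gate (Idx n d)), WF gs → (∀ gt ∈ gs, gt.fn ∈ monotoneBasis) →
      ∃ (ap : Idx n d ⊕ ℕ → Option (Approx n d)) (BadP : Finset (PosΩ n d A))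
        (BadN : Finset (NegΩ n d)),
        #BadP ≤ gs.length * ((A ^ d - φ) ^ (m + 1) * (A ^ d) ^ (2 * n - (m + 1))) ∧
        #BadN * #H ^ d ≤ gs.length * (2 * (m * m * 2 ^ d) * #H ^ d + 2 * (m * (n * φ ^ K))) ∧
        ∀ w : Idx n d ⊕ ℕ, OutOK gs.length w →
          IsApprox A m φ BadP BadN (ap w) (fun x => wireOf x (vals gs x) w) := by
  intro gs
  induction gs using List.reverseRecOn with
  | nil =>
    intro _ _
    refine ⟨fun w => match w with
      | .inl i => some (Approx.leaf i)
      | .inr _ => none, ∅, ∅, by simp, by simp, fun w hw => ?_⟩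
    rcases w with i | k
    · exact IsApprox.leaf hA hm hφ1 i
    · exact absurd (hw k rfl) (by simp)
  | append_singleton gs gt ih =>
    intro hwf hB
    obtain ⟨ap, BadP, BadN, hcP, hcN, hinv⟩ :=
      ih hwf.of_append_left fun g' hg' => hB g' (List.mem_append_left _ hg')
    have hgOK : GateOK gs.length gt := hwf.gateOK_mid (post := [])
    have hgB : gt.fn ∈ monotoneBasis := hB gt (by simp)
    set EA := (A ^ d - φ) ^ (m + 1) * (A ^ d) ^ (2 * n - (m + 1)) with hEA
    set EO := 2 * (m * m * 2 ^ d) * #H ^ d + 2 * (m * (n * φ ^ K)) with hEO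
    -- old wires keep their values and invariants
    have hold : ∀ (BadP' : Finset (PosΩ n d A)) (BadN' : Finset (NegΩ n d)),
        BadP ⊆ BadP' → BadN ⊆ BadN' → ∀ w : Idx n d ⊕ ℕ, OutOK gs.length w →
        IsApprox A m φ BadP' BadN' (ap w) (fun x => wireOf x (vals (gs ++ [gt]) x) w) :=
      fun BadP' BadN' hP hN w hw =>
        ((hinv w hw).mono hP hN).congr fun x => (wireOf_vals_append gs [gt] x w hw).symm
    -- the value of the new gate
    have hnew : ∀ x, wireOf x (vals (gs ++ [gt]) x) (.inr gs.length) =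
        gt.op (fun a => wireOf x (vals gs x) (gt.args a)) := fun x => by
      rw [wireOf_inr, show gs ++ [gt] = gs ++ gt :: [] from rfl, getD_vals_append_cons]
    -- how to assemble the conclusion from an approximator of the new gate
    have assemble : ∀ (BadP' : Finset (PosΩ n d A)) (BadN' : Finset (NegΩ n d))
        (Fn : Option (Approx n d)),
        BadP ⊆ BadP' → BadN ⊆ BadN' → #BadP' ≤ (gs ++ [gt]).length * EA →
        #BadN' * #H ^ d ≤ (gs ++ [gt]).length * EO →
        IsApprox A m φ BadP' BadN' Fn (fun x => wireOf x (vals (gs ++ [gt]) x) (.inr gs.length)) →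
        ∃ (ap : Idx n d ⊕ ℕ → Option (Approx n d)) (BadP : Finset (PosΩ n d A))
          (BadN : Finset (NegΩ n d)),
          #BadP ≤ (gs ++ [gt]).length * EA ∧ #BadN * #H ^ d ≤ (gs ++ [gt]).length * EO ∧
          ∀ w : Idx n d ⊕ ℕ, OutOK (gs ++ [gt]).length w →
            IsApprox A m φ BadP BadN (ap w) (fun x => wireOf x (vals (gs ++ [gt]) x) w) := by
      intro BadP' BadN' Fn hPP' hNN' hcP' hcN' hnewinv
      refine ⟨fun w => if w = .inr gs.length then Fn else ap w, BadP', BadN', hcP', hcN',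
        fun w hw => ?_⟩
      by_cases hwn : w = .inr gs.length
      · subst hwn
        simpa using hnewinv
      · dsimp only
        rw [if_neg hwn]
        refine hold BadP' BadN' hPP' hNN' w fun k hk => ?_
        have h1 := hw k hk
        simp only [List.length_append, List.length_singleton] at h1
        have h2 : k ≠ gs.length := fun h => hwn (hk.trans (by rw [h]))
        omega
    have hlen : (gs ++ [gt]).length = gs.length + 1 := by simp
    simp only [monotoneBasis, Set.mem_insert_iff, Set.mem_singleton_iff] at hgB
    rcases hgB with hc | hc
    · -- AND gate
      obtain ⟨u, v, rfl⟩ := exists_eq_andGate_of_fn_eq hc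
      have hu : OutOK gs.length u := fun k hk => hgOK (0 : Fin 2) k hk
      have hv : OutOK gs.length v := fun k hk => hgOK (1 : Fin 2) k hk
      have hnewinv := IsApprox.and_gate (hinv u hu) (hinv v hv)
      have hcP' : #(BadP ∪ errAndO A m (ap u) (ap v)) ≤ (gs.length + 1) * EA :=
        calc #(BadP ∪ errAndO A m (ap u) (ap v)) ≤ #BadP + #(errAndO A m (ap u) (ap v)) :=
              card_union_le _ _
          _ ≤ gs.length * EA + EA :=
              Nat.add_le_add hcP (card_errAndO_le (hinv u hu) (hinv v hv) hφ2)
          _ = (gs.length + 1) * EA := by ring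
      refine assemble (BadP ∪ errAndO A m (ap u) (ap v)) BadN _ subset_union_left Subset.rfl
        (by rw [hlen]; exact hcP') (hcN.trans (Nat.mul_le_mul_right _ (by simp)))
        (hnewinv.congr fun x => ?_)
      rw [hnew, andGate_op]
    · -- OR gate
      obtain ⟨u, v, rfl⟩ := exists_eq_orGate_of_fn_eq hc
      have hu : OutOK gs.length u := fun k hk => hgOK (0 : Fin 2) k hk
      have hv : OutOK gs.length v := fun k hk => hgOK (1 : Fin 2) k hk
      have hnewinv := IsApprox.or_gate (hinv u hu) (hinv v hv)
      have hcN' : #(BadN ∪ errOrO A φ (ap u) (ap v)) * #H ^ d ≤ (gs.length + 1) * EO :=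
        calc #(BadN ∪ errOrO A φ (ap u) (ap v)) * #H ^ d
            ≤ (#BadN + #(errOrO A φ (ap u) (ap v))) * #H ^ d :=
              Nat.mul_le_mul_right _ (card_union_le _ _)
          _ = #BadN * #H ^ d + #(errOrO A φ (ap u) (ap v)) * #H ^ d := by ring
          _ ≤ gs.length * EO + EO :=
              Nat.add_le_add hcN (card_errOrO_mul_le (hinv u hu) (hinv v hv) H hZ hH)
          _ = (gs.length + 1) * EO := by ring
      refine assemble BadP (BadN ∪ errOrO A φ (ap u) (ap v)) _ Subset.rfl subset_union_left
        (hcP.trans (Nat.mul_le_mul_right _ (by simp))) (by rw [hlen]; exact hcN')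
        (hnewinv.congr fun x => ?_)
      rw [hnew, orGate_op]

/-- **The dichotomy** (Choudhury et al. 2026, proof of Theorem 5, Cases 1 and 2, in counting
form). For a circuit of size `s` over `{∧₂, ∨₂}` computing `¬OV_{n,d}`, with the parameters
`A, K, m, φ` and a half-size set `H` as above: either the output approximator is the constant `0`
and then all but `n² ((A²-1) A^{2n-2})^d` of the `(A^d)^{2n}` positive samples are false
negatives, at most `(A^d - φ)^{m+1} (A^d)^{2n-m-1}` per gate (Case 1, Lemmas 17 and 21); or it is
non-zero and then all but `2 m n 2^d` of the `n² 2^d` negative samples are false positives, at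
most `2m² 2^d + 2 m n φ^K / #H^d` per gate (Case 2, Lemmas 20 and 23).
[cite: arXiv260723799, Theorem 5] -/
theorem dichotomy {K m φ : ℕ} (hA : 1 ≤ A) (hm : 1 ≤ m)
    (hφ1 : φ ≤ (A - 1) * A ^ (d - 1)) (hφ2 : φ ≤ A ^ d)
    (H : Finset (Fin K → Fin A)) (hZ : ∀ v : Fin K → Fin A, (∃ k, (v k : ℕ) = 0) → v ∈ H)
    (hH : #Hᶜ = #H) (C : Complexity.Circuit (Idx n d)) (hC : C.IsOver monotoneBasis)
    (hf : C.Computes (Cryptography.notOVFn n d)) :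
    (A ^ d) ^ (2 * n) ≤ C.size * ((A ^ d - φ) ^ (m + 1) * (A ^ d) ^ (2 * n - (m + 1))) +
        n ^ 2 * ((A ^ 2 - 1) * A ^ (2 * n - 2)) ^ d ∨
      n * n * 2 ^ d * #H ^ d ≤ C.size * (2 * (m * m * 2 ^ d) * #H ^ d + 2 * (m * (n * φ ^ K))) +
        2 * m * (n * 2 ^ d) * #H ^ d := by
  obtain ⟨ap, BadP, BadN, hcP, hcN, hinv⟩ :=
    exists_isApprox_gates hA hm hφ1 hφ2 H hZ hH C.gates (wf_gates C) hC
  have h := hinv C.output C.wf_output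
  have hev : ∀ x, wireOf x (vals C.gates x) C.output = Cryptography.notOVFn n d x := fun x => by
    rw [← circuit_eval]; exact hf x
  rcases hF : ap C.output with _ | F
  · -- Case 1: the output approximator is `0`; every accepted positive sample is bad
    left
    have hsub : (univ.filter fun ω : PosΩ n d A => Cryptography.notOVFn n d (posInp ω) = true) ⊆
        BadP := by
      intro ω hω
      rw [mem_filter] at hω
      rcases h.pos ω ((hev _).trans hω.2) with h' | h'
      · rw [hF] at h'
        simp [evalO] at h'
      · exact h'
    have htot := card_filter_add_card_filter_not (s := (univ : Finset (PosΩ n d A)))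
      (fun ω => Cryptography.notOVFn n d (posInp ω) = true)
    simp only [Bool.not_eq_true] at htot
    rw [card_univ, Fintype.card_fun, Fintype.card_prod, Fintype.card_fin, Fintype.card_fin,
      Fintype.card_fun, Fintype.card_fin, Fintype.card_fin] at htot
    have h1 := card_le_card hsub
    have h2 := card_filter_notOVFn_posInp_false_le (n := n) (d := d) hA
    calc (A ^ d) ^ (2 * n) = _ := htot.symm
      _ ≤ #BadP + n ^ 2 * ((A ^ 2 - 1) * A ^ (2 * n - 2)) ^ d := Nat.add_le_add h1 h2
      _ ≤ _ := Nat.add_le_add_right hcP _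
  · -- Case 2: the output approximator is non-zero; every negative sample it accepts is bad
    right
    have hFv : F.Valid A m φ := h.valid F hF
    have hsub : (univ.filter fun ω : NegΩ n d => F.eval (negInp ω) = true) ⊆ BadN := by
      intro ω hω
      rw [mem_filter] at hω
      have hω' : evalO (ap C.output) (negInp ω) = true := by rw [hF]; exact hω.2
      rcases h.neg ω hω' with h' | h'
      · rw [hev, notOVFn_negInp] at h'
        exact absurd h' Bool.false_ne_true
      · exact h'
    have htot := card_filter_add_card_filter_not (s := (univ : Finset (NegΩ n d)))
      (fun ω => F.eval (negInp ω) = true)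
    simp only [Bool.not_eq_true] at htot
    rw [card_univ, Fintype.card_prod, Fintype.card_prod, Fintype.card_fin, card_boolVec] at htot
    have h1 := card_le_card hsub
    have h2 := Approx.card_filter_eval_negInp_false_le A hFv
    have h3 : (#F.SU + #F.SV) * (n * 2 ^ d) ≤ 2 * m * (n * 2 ^ d) :=
      Nat.mul_le_mul_right _ (by linarith [hFv.cardU, hFv.cardV])
    calc n * n * 2 ^ d * #H ^ d = (n * (n * 2 ^ d)) * #H ^ d := by ring
      _ = (#(univ.filter fun ω : NegΩ n d => F.eval (negInp ω) = true) +
            #(univ.filter fun ω : NegΩ n d => F.eval (negInp ω) = false)) * #H ^ d := by rw [htot]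
      _ ≤ (#BadN + 2 * m * (n * 2 ^ d)) * #H ^ d :=
          Nat.mul_le_mul_right _ (Nat.add_le_add h1 (h2.trans h3))
      _ = #BadN * #H ^ d + 2 * m * (n * 2 ^ d) * #H ^ d := by ring
      _ ≤ _ := Nat.add_le_add_right hcN _


/-! ### Asymptotics of the parameters -/

open Filter Real

/-- The eventual inequalities between the parameters used in the proof of Theorem 5: for fixed
`K ≥ 3` and `ε > 0`, for all large `n`: `n ≥ 8`, `4 ⌈n^{2/K}⌉ ≤ n`, `n^{-1/K} ≤ 1/2`,
`n^{ε/2} ≥ 32` and `ln 2 + 2 ln n ≤ n^{1/K} / 2` (since `ln n = o(n^{1/K})`). [folklore] -/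
theorem eventually_params (K : ℕ) (hK : 3 ≤ K) {ε : ℝ} (hε : 0 < ε) :
    ∀ᶠ n : ℕ in atTop, 8 ≤ n ∧ 4 * ⌈(n : ℝ) ^ ((2 : ℝ) / K)⌉₊ ≤ n ∧
      (n : ℝ) ^ (-(1 : ℝ) / K) ≤ 1 / 2 ∧ 32 ≤ (n : ℝ) ^ (ε / 2) ∧
      Real.log 2 + 2 * Real.log n ≤ (n : ℝ) ^ ((1 : ℝ) / K) / 2 := by
  have hK0 : (0 : ℝ) < K := by exact_mod_cast (by omega : 0 < K)
  have hK2 : (2 : ℝ) / K < 1 := by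
    rw [div_lt_one hK0]
    exact_mod_cast (by omega : 2 < K)
  have h1 : ∀ᶠ n : ℕ in atTop, 8 ≤ n := eventually_ge_atTop 8
  have h2r : Tendsto (fun x : ℝ => x ^ (-(1 - 2 / (K : ℝ)))) atTop (nhds 0) :=
    tendsto_rpow_neg_atTop (by linarith)
  have h2 : ∀ᶠ n : ℕ in atTop, (n : ℝ) ^ (-(1 - 2 / (K : ℝ))) ≤ 1 / 8 :=
    tendsto_natCast_atTop_atTop.eventually (h2r.eventually_le_const (by norm_num))
  have h3r : Tendsto (fun x : ℝ => x ^ (-((1 : ℝ) / K))) atTop (nhds 0) :=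
    tendsto_rpow_neg_atTop (by positivity)
  have h3 : ∀ᶠ n : ℕ in atTop, (n : ℝ) ^ (-((1 : ℝ) / K)) ≤ 1 / 2 :=
    tendsto_natCast_atTop_atTop.eventually (h3r.eventually_le_const (by norm_num))
  have h4 : ∀ᶠ n : ℕ in atTop, 32 ≤ (n : ℝ) ^ (ε / 2) :=
    tendsto_natCast_atTop_atTop.eventually
      ((tendsto_rpow_atTop (by positivity)).eventually_ge_atTop 32)
  have h5a : ∀ᶠ x : ℝ in atTop, ‖Real.log x‖ ≤ 1 / 8 * ‖x ^ ((1 : ℝ) / K)‖ :=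
    (isLittleO_log_rpow_atTop (by positivity)).def (by norm_num)
  have h5b : ∀ᶠ x : ℝ in atTop, 4 * Real.log 2 ≤ x ^ ((1 : ℝ) / K) :=
    (tendsto_rpow_atTop (by positivity)).eventually_ge_atTop _
  have h5 : ∀ᶠ n : ℕ in atTop, Real.log 2 + 2 * Real.log n ≤ (n : ℝ) ^ ((1 : ℝ) / K) / 2 := by
    filter_upwards [tendsto_natCast_atTop_atTop.eventually h5a,
      tendsto_natCast_atTop_atTop.eventually h5b, h1] with n ha hb hn
    have hlog : 0 ≤ Real.log n := Real.log_nonneg (by exact_mod_cast (by omega : 1 ≤ n))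
    have hrp : 0 ≤ (n : ℝ) ^ ((1 : ℝ) / K) := rpow_nonneg (by positivity) _
    rw [Real.norm_of_nonneg hlog, Real.norm_of_nonneg hrp] at ha
    linarith
  filter_upwards [h1, h2, h3, h4, h5] with n hn h2 h3 h4 h5
  refine ⟨hn, ?_, ?_, h4, h5⟩
  · have hn0 : (0 : ℝ) < n := by exact_mod_cast (by omega : 0 < n)
    have hn8 : (8 : ℝ) ≤ n := by exact_mod_cast hn
    have hx : (n : ℝ) ^ ((2 : ℝ) / K) ≤ n / 8 := by
      rw [show (2 : ℝ) / K = 1 + -(1 - 2 / (K : ℝ)) by ring, rpow_add hn0, rpow_one]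
      have := mul_le_mul_of_nonneg_left h2 hn0.le
      linarith
    have hceil : (⌈(n : ℝ) ^ ((2 : ℝ) / K)⌉₊ : ℝ) < (n : ℝ) ^ ((2 : ℝ) / K) + 1 :=
      Nat.ceil_lt_add_one (rpow_nonneg hn0.le _)
    have h : ((4 * ⌈(n : ℝ) ^ ((2 : ℝ) / K)⌉₊ : ℕ) : ℝ) ≤ n := by
      push_cast
      linarith
    exact_mod_cast h
  · rw [neg_div]
    exact h3


/-- `(1 - 1/N)^N ≤ 1/2` for `N ≥ 1` (from `(1 - t/N)^N ≤ e^{-t}` and `e ≥ 2`). [folklore] -/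
theorem one_sub_inv_pow_le_half (N : ℕ) (hN : 1 ≤ N) : (1 - 1 / (N : ℝ)) ^ N ≤ 1 / 2 := by
  have h1 := Real.one_sub_div_pow_le_exp_neg (n := N) (t := 1) (by exact_mod_cast hN)
  have h2 : Real.exp (-1) ≤ 1 / 2 := by
    rw [Real.exp_neg, one_div, inv_le_inv₀ (Real.exp_pos 1) two_pos]
    have := Real.add_one_le_exp 1
    norm_num at this
    exact this
  exact h1.trans h2

/-! ### Proof of Theorem 5 -/

/-- **Case 1 of the proof of Theorem 5** (the output approximator is `0`), arithmetic part: from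
`(A^d)^{2n} ≤ s (A^d - φ)^{m+1} (A^d)^{2n-m-1} + n² ((A²-1) A^{2n-2})^d` and the parameter
inequalities, `s ≥ n²` (indeed `s ≥ e^{n^{1/K}/2} / 2`; Choudhury et al. 2026, proof of Thm. 5,
Case 1 with Lemma 17). [cite: arXiv260723799, Theorem 5] -/
theorem case1_arith (K n L d A m φ ψ B sz : ℕ) (hK : 3 ≤ K) (hn8 : 8 ≤ n) (hL1 : 1 ≤ L)
    (hnL : n < 2 ^ (L + 1)) (hd : d = 24 * K ^ 2 * L) (hA : A = 2 * K) (hψφ : ψ + φ = A ^ d)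
    (hB1 : B + 1 = A ^ 2) (hm4 : 4 * m ≤ n) (hmge : (n : ℝ) ^ ((2 : ℝ) / K) ≤ m)
    (hδ : (n : ℝ) ^ (-(1 : ℝ) / K) ≤ 1 / 2)
    (hφ_ge : (n : ℝ) ^ (-(1 : ℝ) / K) * (A : ℝ) ^ d / 2 ≤ φ)
    (hlog : Real.log 2 + 2 * Real.log n ≤ (n : ℝ) ^ ((1 : ℝ) / K) / 2)
    (h1 : (A ^ d) ^ (2 * n) ≤
      sz * (ψ ^ (m + 1) * (A ^ d) ^ (2 * n - (m + 1))) + n ^ 2 * (B * A ^ (2 * n - 2)) ^ d) :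
    (n : ℝ) ^ 2 ≤ sz := by
  have hK0 : (0 : ℝ) < K := by exact_mod_cast (by omega : 0 < K)
  have hn0 : (0 : ℝ) < n := by exact_mod_cast (by omega : 0 < n)
  have hA2 : 2 ≤ A := by omega
  have hAr : (2 : ℝ) ≤ A := by exact_mod_cast hA2
  have hA2sq : 1 ≤ A ^ 2 := Nat.one_le_pow _ _ (by omega)
  set a : ℝ := (A : ℝ) ^ d with ha
  have ha0 : 0 < a := by positivity
  set s : ℝ := (sz : ℝ) with hs
  have hs0 : 0 ≤ s := Nat.cast_nonneg _
  -- cast the hypothesis to `ℝ`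
  have h1r : a ^ (2 * n) ≤ s * ((ψ : ℝ) ^ (m + 1) * a ^ (2 * n - (m + 1))) +
      (n : ℝ) ^ 2 * ((B : ℝ) * (A : ℝ) ^ (2 * n - 2)) ^ d := by
    have := (Nat.cast_le (α := ℝ)).2 h1
    push_cast at this
    exact this
  have hψr : (ψ : ℝ) = a - φ := by
    have := congrArg (Nat.cast (R := ℝ)) hψφ
    push_cast at this
    rw [ha]
    linarith
  have hBr : (B : ℝ) = (A : ℝ) ^ 2 - 1 := by
    have := congrArg (Nat.cast (R := ℝ)) hB1
    push_cast at this
    linarith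
  -- the threshold as a probability
  set δ : ℝ := (n : ℝ) ^ (-(1 : ℝ) / K) / 2 with hδdef
  have hδpos : 0 < δ := by
    have : 0 < (n : ℝ) ^ (-(1 : ℝ) / K) := rpow_pos_of_pos hn0 _
    positivity
  have hδle : δ ≤ 1 / 4 := by rw [hδdef]; linarith
  -- term 1: `s (a - φ)^{m+1} a^{2n-m-1} ≤ s (1 - δ)^{m+1} a^{2n}`
  have hmn : m + 1 ≤ 2 * n := by omega
  have ht1 : (ψ : ℝ) ^ (m + 1) * a ^ (2 * n - (m + 1)) ≤ (1 - δ) ^ (m + 1) * a ^ (2 * n) := by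
    have hψle : (ψ : ℝ) ≤ (1 - δ) * a := by
      rw [hψr, hδdef]
      linarith
    have hψ0 : 0 ≤ (ψ : ℝ) := Nat.cast_nonneg _
    calc (ψ : ℝ) ^ (m + 1) * a ^ (2 * n - (m + 1))
        ≤ ((1 - δ) * a) ^ (m + 1) * a ^ (2 * n - (m + 1)) :=
          mul_le_mul_of_nonneg_right (pow_le_pow_left₀ hψ0 hψle _) (pow_nonneg ha0.le _)
      _ = (1 - δ) ^ (m + 1) * (a ^ (m + 1) * a ^ (2 * n - (m + 1))) := by rw [mul_pow]; ring
      _ = (1 - δ) ^ (m + 1) * a ^ (2 * n) := by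
          rw [← pow_add]
          congr 2
          omega
  -- term 2: `n² ((A²-1) A^{2n-2})^d ≤ a^{2n} / 4`
  have ht2 : (n : ℝ) ^ 2 * ((B : ℝ) * (A : ℝ) ^ (2 * n - 2)) ^ d ≤ 1 / 4 * a ^ (2 * n) := by
    have hA2pos : (0 : ℝ) < (A : ℝ) ^ 2 := by positivity
    have hsplit : ((B : ℝ) * (A : ℝ) ^ (2 * n - 2)) ^ d =
        (1 - 1 / (A : ℝ) ^ 2) ^ d * a ^ (2 * n) := by
      have hq : (B : ℝ) = (1 - 1 / (A : ℝ) ^ 2) * (A : ℝ) ^ 2 := by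
        rw [hBr]
        field_simp
      have hpow : (A : ℝ) ^ 2 * (A : ℝ) ^ (2 * n - 2) = (A : ℝ) ^ (2 * n) := by
        rw [← pow_add]
        congr 1
        omega
      calc ((B : ℝ) * (A : ℝ) ^ (2 * n - 2)) ^ d
          = ((1 - 1 / (A : ℝ) ^ 2) * ((A : ℝ) ^ 2 * (A : ℝ) ^ (2 * n - 2))) ^ d := by
            rw [hq]; ring
        _ = (1 - 1 / (A : ℝ) ^ 2) ^ d * ((A : ℝ) ^ (2 * n)) ^ d := by rw [hpow, mul_pow]
        _ = (1 - 1 / (A : ℝ) ^ 2) ^ d * a ^ (2 * n) := by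
            rw [ha, ← pow_mul, ← pow_mul, mul_comm (2 * n) d]
    have h01 : 0 ≤ 1 - 1 / (A : ℝ) ^ 2 := by
      rw [sub_nonneg, div_le_one hA2pos]
      exact one_le_pow₀ (by linarith)
    have hq1 : (1 - 1 / (A : ℝ) ^ 2) ^ d ≤ (1 / 2) ^ (6 * L) := by
      have hbase := one_sub_inv_pow_le_half (A ^ 2) hA2sq
      push_cast at hbase
      have hd' : d = A ^ 2 * (6 * L) := by rw [hd, hA]; ring
      rw [hd', pow_mul]
      exact pow_le_pow_left₀ (pow_nonneg h01 _) hbase _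
    have hn2 : (n : ℝ) ^ 2 < 4 * 4 ^ L := by
      have hT : ((2 : ℝ) ^ L) ^ 2 = 4 ^ L := by
        rw [← pow_mul, mul_comm, pow_mul]
        norm_num
      have h : (n : ℝ) < 2 * 2 ^ L := by
        have : ((n : ℕ) : ℝ) < ((2 ^ (L + 1) : ℕ) : ℝ) := by exact_mod_cast hnL
        push_cast at this
        rw [pow_succ] at this
        linarith
      have h' := pow_lt_pow_left₀ h hn0.le two_ne_zero
      rw [mul_pow, hT] at h'
      linarith
    have h64 : (1 / 2 : ℝ) ^ (6 * L) * 4 ^ L = (1 / 16) ^ L := by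
      rw [pow_mul, ← mul_pow]
      norm_num
    have h16 : (1 / 16 : ℝ) ^ L ≤ 1 / 16 := pow_le_of_le_one (by norm_num) (by norm_num) (by omega)
    rw [hsplit]
    have hq0 : 0 ≤ (1 - 1 / (A : ℝ) ^ 2) ^ d := pow_nonneg h01 _
    have key : (n : ℝ) ^ 2 * (1 - 1 / (A : ℝ) ^ 2) ^ d ≤ 1 / 4 := by
      calc (n : ℝ) ^ 2 * (1 - 1 / (A : ℝ) ^ 2) ^ d ≤ (4 * 4 ^ L) * (1 / 2) ^ (6 * L) :=
            mul_le_mul hn2.le hq1 hq0 (by positivity)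
        _ = 4 * (1 / 16) ^ L := by rw [← h64]; ring
        _ ≤ 4 * (1 / 16) := by linarith
        _ = 1 / 4 := by norm_num
    calc (n : ℝ) ^ 2 * ((1 - 1 / (A : ℝ) ^ 2) ^ d * a ^ (2 * n))
        = ((n : ℝ) ^ 2 * (1 - 1 / (A : ℝ) ^ 2) ^ d) * a ^ (2 * n) := by ring
      _ ≤ 1 / 4 * a ^ (2 * n) := mul_le_mul_of_nonneg_right key (pow_nonneg ha0.le _)
  -- hence `3/4 ≤ s (1 - δ)^{m+1}`
  have h34 : 3 / 4 ≤ s * (1 - δ) ^ (m + 1) := by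
    have hpow0 : 0 < a ^ (2 * n) := pow_pos ha0 _
    have h : 1 * a ^ (2 * n) ≤ (s * (1 - δ) ^ (m + 1) + 1 / 4) * a ^ (2 * n) := by
      calc 1 * a ^ (2 * n) = a ^ (2 * n) := one_mul _
        _ ≤ _ := h1r
        _ ≤ s * ((1 - δ) ^ (m + 1) * a ^ (2 * n)) + 1 / 4 * a ^ (2 * n) :=
            add_le_add (mul_le_mul_of_nonneg_left ht1 hs0) ht2
        _ = (s * (1 - δ) ^ (m + 1) + 1 / 4) * a ^ (2 * n) := by ring
    have := le_of_mul_le_mul_right h hpow0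
    linarith
  -- `(1 - δ)^{m+1} ≤ exp(-n^{1/K}/2) ≤ 1/(2n²)`
  have hexp : (1 - δ) ^ (m + 1) ≤ 1 / (2 * (n : ℝ) ^ 2) := by
    have h1 : (1 - δ) ^ (m + 1) ≤ Real.exp (-δ) ^ (m + 1) :=
      pow_le_pow_left₀ (by linarith) (by linarith [Real.add_one_le_exp (-δ)]) _
    have h2 : Real.exp (-δ) ^ (m + 1) = Real.exp ((m + 1 : ℕ) * -δ) := (Real.exp_nat_mul _ _).symm
    have h3 : ((m + 1 : ℕ) : ℝ) * -δ ≤ -((n : ℝ) ^ ((1 : ℝ) / K) / 2) := by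
      have hprod : (n : ℝ) ^ ((2 : ℝ) / K) * (n : ℝ) ^ (-(1 : ℝ) / K) = (n : ℝ) ^ ((1 : ℝ) / K) := by
        rw [← rpow_add hn0]
        congr 1
        ring
      have hmδ : (n : ℝ) ^ ((1 : ℝ) / K) / 2 ≤ (m : ℝ) * δ := by
        rw [hδdef, ← hprod]
        have := mul_le_mul_of_nonneg_right hmge (le_of_lt (rpow_pos_of_pos hn0 (-(1 : ℝ) / K)))
        linarith
      push_cast
      linarith
    have h4 : Real.exp (-((n : ℝ) ^ ((1 : ℝ) / K) / 2)) ≤ 1 / (2 * (n : ℝ) ^ 2) := by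
      have he : Real.exp (Real.log 2 + 2 * Real.log n) = 2 * (n : ℝ) ^ 2 := by
        rw [Real.exp_add, Real.exp_log two_pos,
          show (2 : ℝ) * Real.log n = ((2 : ℕ) : ℝ) * Real.log n by norm_num,
          Real.exp_nat_mul, Real.exp_log hn0]
      calc Real.exp (-((n : ℝ) ^ ((1 : ℝ) / K) / 2))
          ≤ Real.exp (-(Real.log 2 + 2 * Real.log n)) := Real.exp_le_exp.2 (by linarith)
        _ = 1 / (2 * (n : ℝ) ^ 2) := by rw [Real.exp_neg, he, one_div]
    calc (1 - δ) ^ (m + 1) ≤ Real.exp (-δ) ^ (m + 1) := h1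
      _ = Real.exp ((m + 1 : ℕ) * -δ) := h2
      _ ≤ Real.exp (-((n : ℝ) ^ ((1 : ℝ) / K) / 2)) := Real.exp_le_exp.2 h3
      _ ≤ 1 / (2 * (n : ℝ) ^ 2) := h4
  -- so `s ≥ (3/2) n² ≥ n²`
  have h := h34.trans (mul_le_mul_of_nonneg_left hexp hs0)
  rw [mul_one_div, le_div_iff₀ (by positivity)] at h
  linarith

/-- **Case 2 of the proof of Theorem 5** (the output approximator is non-zero), arithmetic part:
from `n² 2^d #H^d ≤ s (2m² 2^d #H^d + 2 m n φ^K) + 2 m n 2^d #H^d` and the parameter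
inequalities, `s ≥ n^{2-4/K}/32 ≥ n^{2-ε}` (Choudhury et al. 2026, proof of Thm. 5, Case 2
with Lemma 20). [cite: arXiv260723799, Theorem 5] -/
theorem case2_arith (K n d A m φ h sz : ℕ) {ε : ℝ} (hK : 3 ≤ K) (hε : 0 < ε) (hKε : 8 / ε ≤ K)
    (hn8 : 8 ≤ n) (hh : 2 * h = A ^ K) (hA1 : 1 ≤ A) (hm1 : 1 ≤ m) (hm4 : 4 * m ≤ n)
    (hmr : (m : ℝ) < (n : ℝ) ^ ((2 : ℝ) / K) + 1)
    (hφ_le : (φ : ℝ) ≤ (n : ℝ) ^ (-(1 : ℝ) / K) * (A : ℝ) ^ d) (h32 : 32 ≤ (n : ℝ) ^ (ε / 2))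
    (h2 : n * n * 2 ^ d * h ^ d ≤
      sz * (2 * (m * m * 2 ^ d) * h ^ d + 2 * (m * (n * φ ^ K))) + 2 * m * (n * 2 ^ d) * h ^ d) :
    (n : ℝ) ^ (2 - ε) ≤ sz := by
  have hK0 : (0 : ℝ) < K := by exact_mod_cast (by omega : 0 < K)
  have hn0 : (0 : ℝ) < n := by exact_mod_cast (by omega : 0 < n)
  have hn1 : (1 : ℝ) ≤ n := by exact_mod_cast (by omega : 1 ≤ n)
  set a : ℝ := (A : ℝ) ^ d with ha
  have ha0 : 0 < a := by positivity
  set s : ℝ := (sz : ℝ) with hs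
  have hs0 : 0 ≤ s := Nat.cast_nonneg _
  set M : ℝ := (2 : ℝ) ^ d * (h : ℝ) ^ d with hM
  have hMa : M = a ^ K := by
    have hhr : (2 : ℝ) * h = (A : ℝ) ^ K := by exact_mod_cast hh
    rw [hM, ← mul_pow, hhr, ha, ← pow_mul, ← pow_mul, mul_comm]
  have hM0 : 0 < M := by rw [hMa]; positivity
  -- cast the hypothesis to `ℝ`
  have h2r : (n : ℝ) * n * M ≤ s * (2 * ((m : ℝ) * m) * M + 2 * ((m : ℝ) * (n * (φ : ℝ) ^ K))) +
      2 * (m : ℝ) * n * M := by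
    have := (Nat.cast_le (α := ℝ)).2 h2
    push_cast at this
    rw [hM, hs]
    linarith
  -- `n φ^K ≤ a^K = M`
  have hφK : (n : ℝ) * (φ : ℝ) ^ K ≤ M := by
    have hpow : (φ : ℝ) ^ K ≤ ((n : ℝ) ^ (-(1 : ℝ) / K) * a) ^ K :=
      pow_le_pow_left₀ (Nat.cast_nonneg _) hφ_le K
    have hnK : ((n : ℝ) ^ (-(1 : ℝ) / K)) ^ K = (n : ℝ)⁻¹ := by
      rw [← Real.rpow_natCast, ← Real.rpow_mul hn0.le,
        show (-(1 : ℝ) / K * (K : ℕ)) = -1 by field_simp, Real.rpow_neg_one]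
    rw [mul_pow, hnK] at hpow
    calc (n : ℝ) * (φ : ℝ) ^ K ≤ n * ((n : ℝ)⁻¹ * a ^ K) := mul_le_mul_of_nonneg_left hpow hn0.le
      _ = a ^ K := by field_simp
      _ = M := hMa.symm
  -- divide by `M`: `n² ≤ s (2m² + 2m) + 2mn`
  have hmr0 : (1 : ℝ) ≤ m := by exact_mod_cast hm1
  have hm4r : 4 * (m : ℝ) ≤ n := by exact_mod_cast hm4
  have h3 : (n : ℝ) * n ≤ s * (2 * (m : ℝ) * m + 2 * m) + 2 * (m : ℝ) * n := by
    have h : (n : ℝ) * n * M ≤ (s * (2 * (m : ℝ) * m + 2 * m) + 2 * (m : ℝ) * n) * M := by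
      calc (n : ℝ) * n * M ≤ _ := h2r
        _ ≤ s * (2 * ((m : ℝ) * m) * M + 2 * ((m : ℝ) * M)) + 2 * (m : ℝ) * n * M := by
            have : 2 * ((m : ℝ) * (n * (φ : ℝ) ^ K)) ≤ 2 * ((m : ℝ) * M) := by nlinarith
            nlinarith
        _ = (s * (2 * (m : ℝ) * m + 2 * m) + 2 * (m : ℝ) * n) * M := by ring
    exact le_of_mul_le_mul_right h hM0
  -- so `n² ≤ 8 m² s ≤ 32 n^{4/K} s`
  have h4 : (n : ℝ) * n ≤ 8 * ((m : ℝ) * m) * s := by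
    have hmm : (m : ℝ) ≤ m * m := by
      have := mul_le_mul_of_nonneg_left hmr0 (zero_le_one.trans hmr0)
      simpa using this
    have e1 : s * (2 * (m : ℝ) * m + 2 * m) ≤ s * (4 * ((m : ℝ) * m)) :=
      mul_le_mul_of_nonneg_left (by linarith) hs0
    have e2 : 2 * (m : ℝ) * n ≤ n / 2 * n :=
      mul_le_mul_of_nonneg_right (by linarith) hn0.le
    linarith
  have hx1 : 1 ≤ (n : ℝ) ^ ((2 : ℝ) / K) := one_le_rpow hn1 (by positivity)
  have hm2 : (m : ℝ) ≤ 2 * (n : ℝ) ^ ((2 : ℝ) / K) := by linarith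
  have hsq : (n : ℝ) ^ ((2 : ℝ) / K) * (n : ℝ) ^ ((2 : ℝ) / K) = (n : ℝ) ^ ((4 : ℝ) / K) := by
    rw [← rpow_add hn0]
    congr 1
    ring
  have h5 : (n : ℝ) * n ≤ 32 * (n : ℝ) ^ ((4 : ℝ) / K) * s := by
    have hmm : (m : ℝ) * m ≤ 4 * (n : ℝ) ^ ((4 : ℝ) / K) := by
      rw [← hsq]
      have := mul_le_mul hm2 hm2 (Nat.cast_nonneg _) (by positivity)
      linarith
    have := mul_le_mul_of_nonneg_right hmm hs0
    linarith
  -- exponents: `n² = n^{2-ε} · n^{ε - 4/K} · n^{4/K}` and `n^{ε - 4/K} ≥ n^{ε/2} ≥ 32`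
  have hεK : ε / 2 ≤ ε - 4 / K := by
    have : 4 / (K : ℝ) ≤ ε / 2 := by
      rw [div_le_iff₀ hK0]
      have := (div_le_iff₀ hε).1 hKε
      linarith
    linarith
  have h6 : (32 : ℝ) ≤ (n : ℝ) ^ (ε - 4 / K) :=
    h32.trans (rpow_le_rpow_of_exponent_le hn1 hεK)
  have hdecomp : (n : ℝ) * n = (n : ℝ) ^ (2 - ε) * (n : ℝ) ^ (ε - 4 / K) * (n : ℝ) ^ ((4 : ℝ) / K) := by
    rw [← rpow_add hn0, ← rpow_add hn0, show (2 - ε + (ε - 4 / (K : ℝ)) + 4 / K) = (2 : ℕ) by ring,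
      rpow_natCast, pow_two]
  have h7 : (n : ℝ) ^ (2 - ε) * (n : ℝ) ^ (ε - 4 / K) ≤ 32 * s := by
    have hpos : 0 < (n : ℝ) ^ ((4 : ℝ) / K) := rpow_pos_of_pos hn0 _
    have : (n : ℝ) ^ (2 - ε) * (n : ℝ) ^ (ε - 4 / K) * (n : ℝ) ^ ((4 : ℝ) / K) ≤
        32 * s * (n : ℝ) ^ ((4 : ℝ) / K) := by rw [← hdecomp]; linarith
    exact le_of_mul_le_mul_right this hpos
  have hpos2 : 0 ≤ (n : ℝ) ^ (2 - ε) := rpow_nonneg hn0.le _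
  have h8 := mul_le_mul_of_nonneg_left h6 hpos2
  linarith

/-- **Theorem 5 of Choudhury et al. (2026), quantitative core** with all parameters explicit:
for `K ≥ 3`, `ε > 0`, `K ≥ 8/ε`, `n` satisfying the eventual parameter inequalities,
`d = 24K² ⌊log₂ n⌋`, every circuit over `{∧₂, ∨₂}` computing `¬OV_{n,d}` has at least `n^{2-ε}`
gates (alphabet `A = 2K`, i.e. `p = 1/(2K)`; `m = ⌈n^{2/K}⌉`; threshold
`φ = ⌈n^{-1/K} A^d / 2⌉`, i.e. `δ ≈ n^{-1/K}/2`). [cite: arXiv260723799, Theorem 5] -/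
theorem circuit_bound_core (K n L d : ℕ) {ε : ℝ} (hK : 3 ≤ K) (hε : 0 < ε) (hKε : 8 / ε ≤ K)
    (hn8 : 8 ≤ n) (hm4 : 4 * ⌈(n : ℝ) ^ ((2 : ℝ) / K)⌉₊ ≤ n)
    (hδ : (n : ℝ) ^ (-(1 : ℝ) / K) ≤ 1 / 2) (h32 : 32 ≤ (n : ℝ) ^ (ε / 2))
    (hlog : Real.log 2 + 2 * Real.log n ≤ (n : ℝ) ^ ((1 : ℝ) / K) / 2)
    (hL : L = Nat.log 2 n) (hd : d = 24 * K ^ 2 * L)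
    (C : Complexity.Circuit (Idx n d)) (hC : C.IsOver monotoneBasis)
    (hf : C.Computes (Cryptography.notOVFn n d)) :
    (n : ℝ) ^ (2 - ε) ≤ C.size := by
  -- the parameters
  set m := ⌈(n : ℝ) ^ ((2 : ℝ) / K)⌉₊ with hm
  set a : ℝ := ((2 * K : ℕ) : ℝ) ^ d with ha
  set φ := ⌈(n : ℝ) ^ (-(1 : ℝ) / K) * a / 2⌉₊ with hφ
  obtain ⟨H, hZ, hH⟩ := exists_half K (by omega)
  -- elementary facts about them
  have hK0 : (0 : ℝ) < K := by exact_mod_cast (by omega : 0 < K)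
  have hn0 : (0 : ℝ) < n := by exact_mod_cast (by omega : 0 < n)
  have hn1 : (1 : ℝ) ≤ n := by exact_mod_cast (by omega : 1 ≤ n)
  have hL1 : 1 ≤ L := by rw [hL]; exact Nat.log_pos one_lt_two (by omega)
  have hnL : n < 2 ^ (L + 1) := by rw [hL]; exact Nat.lt_pow_succ_log_self one_lt_two n
  have hK2 : 9 ≤ K ^ 2 := by nlinarith
  have hdL : L + 2 ≤ d := by rw [hd]; nlinarith
  have hd1 : 1 ≤ d := by omega
  have hA1 : 1 ≤ 2 * K := by omega
  have hA2 : 2 ≤ 2 * K := by omega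
  have ha0 : 0 < a := by positivity
  have hm1 : 1 ≤ m := Nat.one_le_ceil_iff.2 (rpow_pos_of_pos hn0 _)
  have hmr : (m : ℝ) < (n : ℝ) ^ ((2 : ℝ) / K) + 1 := Nat.ceil_lt_add_one (rpow_nonneg hn0.le _)
  have hmge : (n : ℝ) ^ ((2 : ℝ) / K) ≤ m := Nat.le_ceil _
  have hδ0 : 0 < (n : ℝ) ^ (-(1 : ℝ) / K) := rpow_pos_of_pos hn0 _
  -- `a ≥ 2n`
  have ha2n : 2 * (n : ℝ) ≤ a := by
    have h1 : 2 * n < 2 ^ (L + 2) := by rw [pow_succ]; omega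
    have h2 : 2 ^ (L + 2) ≤ (2 * K) ^ d :=
      (Nat.pow_le_pow_right two_pos hdL).trans (Nat.pow_le_pow_left hA2 d)
    have : ((2 * n : ℕ) : ℝ) ≤ (((2 * K) ^ d : ℕ) : ℝ) := by exact_mod_cast (h1.le.trans h2)
    rw [ha]
    push_cast at this ⊢
    linarith
  -- `φ` is within a factor two of `n^{-1/K} a / 2 ≥ 1`
  have hφ_ge : (n : ℝ) ^ (-(1 : ℝ) / K) * a / 2 ≤ φ := Nat.le_ceil _
  have hx1 : 1 ≤ (n : ℝ) ^ (-(1 : ℝ) / K) * a / 2 := by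
    have h1 : (n : ℝ) ^ (-(1 : ℝ) / K) * n ≤ (n : ℝ) ^ (-(1 : ℝ) / K) * a / 2 := by nlinarith
    have h2 : (1 : ℝ) ≤ (n : ℝ) ^ (-(1 : ℝ) / K) * n := by
      have h3 : (n : ℝ) ^ (-(1 : ℝ) / K) * n = n ^ (1 - (1 : ℝ) / K) := by
        rw [show (1 - (1 : ℝ) / K) = (-(1 : ℝ) / K) + 1 by ring, rpow_add hn0, rpow_one]
      rw [h3]
      refine one_le_rpow hn1 ?_
      have : (1 : ℝ) / K ≤ 1 := by
        rw [div_le_one hK0]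
        exact_mod_cast (by omega : 1 ≤ K)
      linarith
    linarith
  have hφ_le : (φ : ℝ) ≤ (n : ℝ) ^ (-(1 : ℝ) / K) * a := by
    have := Nat.ceil_lt_add_one (by linarith : (0 : ℝ) ≤ (n : ℝ) ^ (-(1 : ℝ) / K) * a / 2)
    rw [← hφ] at this
    linarith
  have hφ_half : (φ : ℝ) ≤ a / 2 := by nlinarith
  have hφ2 : φ ≤ (2 * K) ^ d := by
    have : (φ : ℝ) ≤ (((2 * K) ^ d : ℕ) : ℝ) := by rw [ha] at hφ_half ha0; push_cast at hφ_half ha0 ⊢; linarith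
    exact_mod_cast this
  have hφ1 : φ ≤ (2 * K - 1) * (2 * K) ^ (d - 1) := by
    have h2φ : 2 * φ ≤ (2 * K) ^ d := by
      have : ((2 * φ : ℕ) : ℝ) ≤ (((2 * K) ^ d : ℕ) : ℝ) := by
        rw [ha] at hφ_half; push_cast at hφ_half ⊢; linarith
      exact_mod_cast this
    have hpow : (2 * K) ^ d = (2 * K) * (2 * K) ^ (d - 1) := by
      rw [← pow_succ']
      congr 1
      omega
    rw [hpow] at h2φ
    have h3 : (2 * K) * (2 * K) ^ (d - 1) ≤ 2 * ((2 * K - 1) * (2 * K) ^ (d - 1)) := by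
      rw [← mul_assoc]
      exact Nat.mul_le_mul_right _ (by omega)
    omega
  -- the dichotomy
  rcases dichotomy hA1 hm1 hφ1 hφ2 H hZ hH C hC hf with h1 | h2
  · -- Case 1
    have hψφ : (2 * K) ^ d - φ + φ = (2 * K) ^ d := Nat.sub_add_cancel hφ2
    have hB1 : (2 * K) ^ 2 - 1 + 1 = (2 * K) ^ 2 := Nat.sub_add_cancel (Nat.one_le_pow _ _ (by omega))
    have key := case1_arith K n L d (2 * K) m φ ((2 * K) ^ d - φ) ((2 * K) ^ 2 - 1) C.size hK hn8
      hL1 hnL hd rfl hψφ hB1 hm4 hmge hδ (by rw [ha] at hφ_ge; exact_mod_cast hφ_ge) hlog h1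
    calc (n : ℝ) ^ (2 - ε) ≤ (n : ℝ) ^ (2 : ℝ) := rpow_le_rpow_of_exponent_le hn1 (by linarith)
      _ = (n : ℝ) ^ 2 := Real.rpow_two _
      _ ≤ C.size := key
  · -- Case 2
    have hh : 2 * #H = (2 * K) ^ K := by
      have := Finset.card_add_card_compl H
      rw [hH, Fintype.card_fun, Fintype.card_fin, Fintype.card_fin] at this
      omega
    exact case2_arith K n d (2 * K) m φ #H C.size hK hε hKε hn8 hh hA1 hm1 hm4 hmr
      (by rw [ha] at hφ_le; exact_mod_cast hφ_le) h32 h2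

/-- **Theorem 5 of Choudhury et al. (2026)**, eventual form: for `K ≥ 3`, `ε > 0` with
`K ≥ 8/ε`, for all large `n`, every circuit over `{∧₂, ∨₂}` computing `¬OV_{n,d}`,
`d = 24K² ⌊log₂ n⌋`, has at least `n^{2-ε}` gates. [cite: arXiv260723799, Theorem 5] -/
theorem circuit_bound (K : ℕ) (hK : 3 ≤ K) {ε : ℝ} (hε : 0 < ε) (hKε : 8 / ε ≤ K) :
    ∀ᶠ n : ℕ in atTop, ∀ C : Complexity.Circuit (Idx n (24 * K ^ 2 * Nat.log 2 n)),
      C.IsOver monotoneBasis → C.Computes (Cryptography.notOVFn n (24 * K ^ 2 * Nat.log 2 n)) →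
        (n : ℝ) ^ (2 - ε) ≤ C.size := by
  filter_upwards [eventually_params K hK hε] with n hev C hC hf
  obtain ⟨hn8, hm4, hδ, h32, hlog⟩ := hev
  exact circuit_bound_core K n (Nat.log 2 n) _ hK hε hKε hn8 hm4 hδ h32 hlog rfl rfl C hC hf

/-- `¬OV_{n,d}` for `n, d ≥ 1` is computed by some circuit over `{∧₂, ∨₂}` (it is monotone,
rejects all-zeros and accepts all-ones, so its monotone DNF is such a circuit;
`cktSize_of_monotone`), so `circuitSizeOver monotoneBasis (notOVFn n d)` is attained.
[folklore] -/
theorem exists_monotone_circuit_notOVFn {n d : ℕ} (hn : 1 ≤ n) (hd : 1 ≤ d) :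
    ∃ C : Complexity.Circuit (Idx n d), C.IsOver monotoneBasis ∧
      C.Computes (Cryptography.notOVFn n d) := by
  have h0 : Cryptography.notOVFn n d (fun _ => false) = false :=
    (notOVFn_eq_false_iff _).2 ⟨⟨0, hn⟩, ⟨0, hn⟩, fun t ht => by simp [vecU] at ht⟩
  have h1 : Cryptography.notOVFn n d (fun _ => true) = true :=
    (notOVFn_eq_true_iff _).2 fun i j hij => hij ⟨0, hd⟩ ⟨rfl, rfl⟩
  obtain ⟨s, hs⟩ := Complexity.cktSize_of_monotone (Cryptography.notOVFn n d)
    (Cryptography.notOVFn_monotone n d) h0 h1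
  obtain ⟨C, hCB, -, hCe⟩ := hs.toCircuit
  exact ⟨C, hCB, fun x => hCe x⟩

end MonotoneOV

open Complexity Filter in
/-- **fine-grained.S25, monotone circuit lower bound for `¬OV`** (Choudhury, Limaye,
Sreenivasaiah, Srinivasan, *New and Improved Concrete Lower Bounds for Orthogonal Vectors*,
arXiv:2607.23799 (2026), Theorem 5: "for every `0 < ε < 1` there is a constant `c` such that for
all `d ≥ c log n` any monotone circuit computing `Int_{n,d}` requires `Ω(n^{2-ε})` gates"), in the
tree's form: for every `ε > 0`, with `c = 24K²`, `K = max(3, ⌈8/ε⌉)`, eventually every circuit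
over `monotoneBasis = {∧₂, ∨₂}` computing `notOVFn n (c ⌊log₂ n⌋)` has at least `n^{2-ε}` gates,
and such circuits exist. Proof: the paper's §4 (approximators local to single vectors,
Lemmas 17, 20–23) in counting form, `MonotoneOV.circuit_bound`. [cite: arXiv260723799, Theorem 5] -/
theorem monotone_circuit_notOV_lower_bound_holds : monotone_circuit_notOV_lower_bound := by
  intro ε hε
  set K : ℕ := max 3 ⌈8 / ε⌉₊ with hK
  have hK3 : 3 ≤ K := le_max_left _ _
  have hKε : 8 / ε ≤ K :=
    (Nat.le_ceil _).trans (by rw [hK]; exact_mod_cast le_max_right 3 _)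
  refine ⟨24 * K ^ 2, by nlinarith, ?_⟩
  filter_upwards [MonotoneOV.circuit_bound K hK3 hε hKε, eventually_ge_atTop 2] with n hn hn2
  have hd1 : 1 ≤ 24 * K ^ 2 * Nat.log 2 n := by
    have : 1 ≤ Nat.log 2 n := Nat.log_pos one_lt_two hn2
    nlinarith
  obtain ⟨C, hCB, hCf⟩ := MonotoneOV.exists_monotone_circuit_notOVFn (n := n) (by omega) hd1
  have hne : {s | ∃ C' : Complexity.Circuit (MonotoneOV.Idx n (24 * K ^ 2 * Nat.log 2 n)),
      C'.IsOver monotoneBasis ∧ C'.Computes (Cryptography.notOVFn n (24 * K ^ 2 * Nat.log 2 n)) ∧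
      C'.size = s}.Nonempty := ⟨C.size, C, hCB, hCf, rfl⟩
  obtain ⟨C', hC'B, hC'f, hC's⟩ := Nat.sInf_mem hne
  unfold circuitSizeOver
  rw [← hC's]
  exact hn C' hC'B hC'f

end Literature.Computability.FineGrained
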